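import Literature.Probability.LatticeModels.SlitPlaneKernelBounds
import Mathlib.Analysis.Complex.HasPrimitives
import Mathlib.Analysis.SpecialFunctions.Complex.LogBounds
import Mathlib.MeasureTheory.Integral.Gamma
import HarnessLib

/-!
# The slit-plane kernel, V: asymptotics of `K(k, s)` by rotating the contour

Topic `Literature/Probability/LatticeModels`; sequel of `SlitPlaneKernel.lean` and
`SlitPlaneKernelBounds.lean`. Chelkak–Hongler–Izyurov (Ann. of Math. 181 (2015) =
arXiv:1202.2838), Lemma 2.14, assert the convergence `ϑ(δ)⁻¹ F_{[ℂ_δ,a]}(z) → 1/√(z - a)` of the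
full-plane spinor, uniformly on compacts (their proof: [ChSm1, Thm 3.13] applied to the tip
harmonic measure of the slit, plus Kesten-type estimates). With the closed form of
`SlitPlaneKernel.lean` and the rational representation
`K(k, s) = (4/π) Re(e^{iπ/4} J(k, s))`, `J(k, s) = ∫_0^1 E(v)^k Y(v)^s A(v) dv`,
`E = (1 - iv²)/(1 + iv²)`, `Y = (1 - v²)/(1 + v²)`, `A = (1 + iv²)⁻¹`
(`SlitPlaneKernelBounds.lean`), this convergence becomes an explicit, quantitative asymptotic
expansion, proved here by the method of steepest descent made rigorous:

* **Contour rotation** (`integral_slitJg_eq_ray_add_arc`, `slitJ_eq_ray_add_arc`): for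
  `|θ| < π/4` the segment `[0, 1]` is replaced by the ray `w ↦ w e^{iθ}` and the unit arc from
  `e^{iθ}` to `1` (Cauchy's theorem through a primitive of the rational integrand on an explicit
  ball `B(½e^{iθ/2}, R)` containing the sector and none of the singular points `v⁴ = -1`,
  `v² = -1`: `dist_sq_lt_sectorRadSq`, `sectorRadSq_le_dist_sq`, Mathlib's
  `DifferentiableOn.isExactOn_ball`).
* **The rotated ray** `θ_a = -arg(a)/2`, `a = s + ik`: `‖E^kY^s(we^{iθ_a})‖ ≤ e^{-‖a‖w²/(1+w⁴)}`
  (`norm_slitEc_zpow_mul_slitYc_pow_le`), and near `0` the phase is Gaussian: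
  `E^kY^s = exp(-2‖a‖w² + R)`, `‖R‖ ≤ (|k| + s)‖v‖⁶` (`norm_phase_remainder_le`, from the cubic
  Taylor bound for `log(1 + z)`), `a (we^{iθ_a})² = ‖a‖ w²` (`slitParam_mul_ray_sq`).
* **The arc** is `O(M/‖a‖²)` (`norm_arc_integral_le`: `‖Y(e^{iφ})‖ ≤ |tan φ|`,
  `‖E(e^{iφ})^k‖ ≤ e^{-|k||sin 2φ|/2}`, Jordan's inequality, and the dichotomy `|k| ≥ s` /
  `|k| < s`).
* **Assembly** (`norm_integral_slitJg_sub_main_le`): for any amplitude `Φ` holomorphic off the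
  singular set with Taylor data `(c₀, c₂)` at `0` and mild bounds on the sector,
  `‖∫_0^1 E^kY^sΦ - e^{iθ_a}(c₀ G₀ + c₂ e^{2iθ_a} G₂)‖ ≤ 2·10⁸ M/‖a‖²`,
  `G₀ = ∫_0^∞ e^{-2‖a‖w²} = ½√(π/(2‖a‖))`, `G₂ = ∫_0^∞ w² e^{-2‖a‖w²} = G₀/(4‖a‖)` (Gaussian moments
  and tails from Mathlib's `integral_gaussian_Ioi`, `integral_rpow_mul_exp_neg_mul_rpow`).
* **The kernel** (`Φ = A`, `c₀ = 1`, `c₂ = -i`): `norm_slitJ_sub_closed_le`,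
  `‖J(k,s) - ½√(π/(2‖a‖)) e^{iθ_a}(1 - i e^{2iθ_a}/(4‖a‖))‖ ≤ 4·10⁸/‖a‖²`, and
  **`abs_slitKernel_sub_le`**: for `s ≥ 1` and all `k`,
  `|K(k, s) - (4/π) Re[e^{iπ/4} ½√(π/(2‖a‖)) e^{iθ_a}(1 - i e^{2iθ_a}/(4‖a‖))]| ≤ 6·10⁸/‖a‖²`.
  The leading term is `√(2/π) Re[(k + is)^{-1/2}]`-shaped (`e^{iπ/4} e^{iθ_a}/√‖a‖ =
  e^{iπ/4} a^{-1/2}`), i.e. `Re(1/√(z - a))` in the lattice coordinates of the slit, with the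
  `1/(4a)` correction; the constants are explicit but not optimised.

* **Consequences**: `abs_slitKernel_sub_trig_le` (the same with the main term written
  `√(2/(π‖a‖)) [cos(π/4 + θ_a) + sin(π/4 + 3θ_a)/(4‖a‖)]`, `cos²(π/4 + θ_a) = (‖a‖ + k)/(2‖a‖)`),
  **`abs_slitKernel_le_near_slit`** (CHI (3.5): `|K(k,s)| ≤ 7·10⁸ s/‖a‖^{3/2}` for `k ≤ 0`), and
  the row `s = 0` through `K(2m,0) = ½[K(2m-1,1) + K(2m+1,1)]` (`abs_slitKernel_row_sub_le`).

Everything is proved; no named fact. NOT here: first differences (the same theorem with the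
amplitudes `A(EY - 1)`, `A(E - Y)`), and the transfer to the continuum statement of Lemma 2.14
on compacts (a change of variables in the main term).

## References

* D. Chelkak, C. Hongler, K. Izyurov, Ann. of Math. 181 (2015) = arXiv:1202.2838: Lemma 2.14,
  §3.2 [ChelkakHonglerIzyurovAnnals2015].
* H. Kesten, Hitting probabilities of random walks on `ℤ^d`, Stoch. Proc. Appl. 25 (1987)
  [Kesten1987] (the exponent `1/2`, here with explicit constants and the full expansion).
-/

noncomputable section

open Complex MeasureTheory intervalIntegral Set Filter Topology Metric
open scoped Real ComplexConjugate Interval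

namespace Literature.Probability.LatticeModels

/-! ### The rational integrand as a function of a complex variable -/

/-- `E(z) = (1 - iz²)/(1 + iz²)`. [folklore] -/
def slitEc (z : ℂ) : ℂ := (1 - I * z ^ 2) / (1 + I * z ^ 2)

/-- `Y(z) = (1 - z²)/(1 + z²)`. [folklore] -/
def slitYc (z : ℂ) : ℂ := (1 - z ^ 2) / (1 + z ^ 2)

/-- `A(z) = (1 + iz²)⁻¹`. [folklore] -/
def slitAc (z : ℂ) : ℂ := (1 + I * z ^ 2)⁻¹

/-- The complexified integrand `E(z)^k Y(z)^s A(z)`. [folklore] -/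
def slitJc (k : ℤ) (s : ℕ) (z : ℂ) : ℂ := slitEc z ^ k * slitYc z ^ s * slitAc z

/-- On the real line the complexified integrand is `slitJFun`. [folklore] -/
theorem slitJc_ofReal (k : ℤ) (s : ℕ) (v : ℝ) : slitJc k s (v : ℂ) = slitJFun k s v := by
  simp only [slitJc, slitJFun, slitEc, slitE, slitYc, slitY, slitAc, slitA]
  push_cast
  ring

/-- The singular set: `1 + iz² = 0`, `1 - iz² = 0` or `1 + z² = 0`. [folklore] -/
def slitPoles : Set ℂ := {z | 1 + I * z ^ 2 = 0 ∨ 1 - I * z ^ 2 = 0 ∨ 1 + z ^ 2 = 0}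

/-- Off the singular set, `E`, `Y`, `A` and `E^k Y^s A` are complex differentiable. [folklore] -/
theorem differentiableAt_slitJc (k : ℤ) (s : ℕ) {z : ℂ} (hz : z ∉ slitPoles) : DifferentiableAt ℂ (slitJc k s) z := by
  simp only [slitPoles, mem_setOf_eq, not_or] at hz
  obtain ⟨h1, h2, h3⟩ := hz
  have hE : DifferentiableAt ℂ slitEc z := by
    unfold slitEc
    exact ((differentiableAt_const _).sub ((differentiableAt_const _).mul (differentiableAt_id.pow 2))).div
      ((differentiableAt_const _).add ((differentiableAt_const _).mul (differentiableAt_id.pow 2))) h1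
  have hEne : slitEc z ≠ 0 := div_ne_zero h2 h1
  have hY : DifferentiableAt ℂ slitYc z := by
    unfold slitYc
    exact ((differentiableAt_const _).sub (differentiableAt_id.pow 2)).div
      ((differentiableAt_const _).add (differentiableAt_id.pow 2)) h3
  have hA : DifferentiableAt ℂ slitAc z := by
    unfold slitAc
    exact ((differentiableAt_const _).add ((differentiableAt_const _).mul (differentiableAt_id.pow 2))).inv h1
  unfold slitJc
  exact ((hE.zpow (Or.inl hEne)).mul (hY.pow s)).mul hA

/-! ### A ball containing the sector `{ρ e^{iφ} : ρ ≤ 1, φ ∈ [θ, 0]}` and no singular point -/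

/-- The centre of the ball: `½ e^{iθ/2}`. [folklore] -/
def sectorCentre (θ : ℝ) : ℂ := ((1 / 2 : ℝ) : ℂ) * cexp ((θ / 2 : ℝ) * I)

/-- The middle cosine `c_m = ½[cos(θ/2) + cos(π/4 - |θ|/2)]`. [folklore] -/
def sectorCosMid (θ : ℝ) : ℝ := (Real.cos (θ / 2) + Real.cos (π / 4 - |θ| / 2)) / 2

/-- The squared radius `R² = 5/4 - c_m`. [folklore] -/
def sectorRadSq (θ : ℝ) : ℝ := 5 / 4 - sectorCosMid θ

/-- `cos(π/4 - |θ|/2) < cos(θ/2)` for `|θ| < π/4`. [folklore] -/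
theorem cos_quarter_lt_cos_half {θ : ℝ} (hθ : |θ| < π / 4) : Real.cos (π / 4 - |θ| / 2) < Real.cos (θ / 2) := by
  have hπ := Real.pi_pos
  rw [← Real.cos_abs (θ / 2), abs_div, abs_two]
  apply Real.cos_lt_cos_of_nonneg_of_le_pi_div_two (by positivity) (by linarith [abs_nonneg θ])
  linarith

/-- `c_m < cos(θ/2)`. [folklore] -/
theorem sectorCosMid_lt {θ : ℝ} (hθ : |θ| < π / 4) : sectorCosMid θ < Real.cos (θ / 2) := by
  unfold sectorCosMid; linarith [cos_quarter_lt_cos_half hθ]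

/-- `cos(π/4 - |θ|/2) < c_m`. [folklore] -/
theorem lt_sectorCosMid {θ : ℝ} (hθ : |θ| < π / 4) : Real.cos (π / 4 - |θ| / 2) < sectorCosMid θ := by
  unfold sectorCosMid; linarith [cos_quarter_lt_cos_half hθ]

/-- `c_m < 1`, so `R² > 1/4`. [folklore] -/
theorem sectorCosMid_lt_one {θ : ℝ} (hθ : |θ| < π / 4) : sectorCosMid θ < 1 :=
  (sectorCosMid_lt hθ).trans_le (Real.cos_le_one _)

/-- The squared distance of `ρ e^{iφ}` to the centre: `ρ² - ρ cos(φ - θ/2) + 1/4`. [folklore] -/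
theorem dist_sq_sectorCentre (θ ρ φ : ℝ) :
    ‖(ρ : ℂ) * cexp ((φ : ℂ) * I) - sectorCentre θ‖ ^ 2 = ρ ^ 2 - ρ * Real.cos (φ - θ / 2) + 1 / 4 := by
  unfold sectorCentre
  rw [show (ρ : ℂ) * cexp ((φ : ℂ) * I) - ((1 / 2 : ℝ) : ℂ) * cexp (((θ / 2 : ℝ) : ℂ) * I) =
      ((ρ * Real.cos φ - 1 / 2 * Real.cos (θ / 2) : ℝ) : ℂ) + ((ρ * Real.sin φ - 1 / 2 * Real.sin (θ / 2) : ℝ) : ℂ) * I by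
    rw [Complex.exp_mul_I, Complex.exp_mul_I, ← ofReal_cos, ← ofReal_sin, ← ofReal_cos, ← ofReal_sin]
    push_cast; ring]
  rw [← Complex.normSq_eq_norm_sq, normSq_add_mul_I, Real.cos_sub]
  nlinarith [Real.sin_sq_add_cos_sq φ, Real.sin_sq_add_cos_sq (θ / 2)]

/-- **The sector lies in the ball**: for `ρ ∈ [0, 1]` and `φ` between `θ` and `0`,
`‖ρe^{iφ} - c‖² < R²`. [folklore] -/
theorem dist_sq_lt_sectorRadSq {θ : ℝ} (hθ : |θ| < π / 4) {ρ : ℝ} (hρ0 : 0 ≤ ρ) (hρ1 : ρ ≤ 1) {φ : ℝ}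
    (hφ : φ ∈ uIcc θ 0) : ‖(ρ : ℂ) * cexp ((φ : ℂ) * I) - sectorCentre θ‖ ^ 2 < sectorRadSq θ := by
  rw [dist_sq_sectorCentre, sectorRadSq]
  have hπ := Real.pi_pos
  -- `cos(φ - θ/2) ≥ cos(θ/2)` since `|φ - θ/2| ≤ |θ|/2 ≤ π`
  have hφ' : |φ - θ / 2| ≤ |θ / 2| := by
    rw [abs_div, abs_two]
    rcases le_total θ 0 with h | h
    · rw [uIcc_of_le h] at hφ; rw [abs_of_nonpos h, abs_le]; constructor <;> linarith [hφ.1, hφ.2]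
    · rw [uIcc_of_ge h] at hφ; rw [abs_of_nonneg h, abs_le]; constructor <;> linarith [hφ.1, hφ.2]
  have h1 : Real.cos (θ / 2) ≤ Real.cos (φ - θ / 2) := by
    rw [← Real.cos_abs (θ / 2), ← Real.cos_abs (φ - θ / 2)]
    exact Real.cos_le_cos_of_nonneg_of_le_pi (abs_nonneg _)
      (by rw [abs_div, abs_two]; linarith [abs_nonneg θ]) hφ'
  have h2 := sectorCosMid_lt hθ
  -- `ρ² - ρ cos ≤ ρ² - ρ cos(θ/2) ≤ max(0, 1 - cos(θ/2)) = 1 - cos(θ/2) < 1 - c_m`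
  have hc1 : Real.cos (θ / 2) ≤ 1 := Real.cos_le_one _
  nlinarith [mul_le_mul_of_nonneg_left h1 hρ0]

/-- **The singular points lie outside the ball**: every `z` with `1 ± iz² = 0` or `1 + z² = 0`
satisfies `‖z - c‖² ≥ R²`. [folklore] -/
theorem sectorRadSq_le_dist_sq {θ : ℝ} (hθ : |θ| < π / 4) {z : ℂ} (hz : z ∈ slitPoles) :
    sectorRadSq θ ≤ ‖z - sectorCentre θ‖ ^ 2 := by
  have hπ := Real.pi_pos
  -- `z² ∈ {i, -i, -1}`, so `‖z‖ = 1`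
  have hz2 : z ^ 2 = I ∨ z ^ 2 = -I ∨ z ^ 2 = -1 := by
    simp only [slitPoles, mem_setOf_eq] at hz
    rcases hz with h | h | h
    · left; linear_combination (-I) * h + z ^ 2 * Complex.I_sq
    · right; left; linear_combination I * h + z ^ 2 * Complex.I_sq
    · right; right; linear_combination h
  have hnz : ‖z‖ = 1 := by
    have h2 : ‖z ^ 2‖ = 1 := by rcases hz2 with h | h | h <;> simp [h]
    rw [norm_pow] at h2
    nlinarith [norm_nonneg z, sq_nonneg (‖z‖ - 1)]
  -- the rotated point `u = z e^{-iθ/2}`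
  set u : ℂ := z * cexp (-(((θ / 2 : ℝ) : ℂ) * I)) with hu
  have hnu : ‖u‖ = 1 := by
    rw [hu, norm_mul, hnz, one_mul, show -(((θ / 2 : ℝ) : ℂ) * I) = ((-(θ / 2) : ℝ) : ℂ) * I by push_cast; ring,
      Complex.norm_exp_ofReal_mul_I]
  have hdist : ‖z - sectorCentre θ‖ ^ 2 = 5 / 4 - u.re := by
    have hcc : conj (sectorCentre θ) = ((1 / 2 : ℝ) : ℂ) * cexp (-(((θ / 2 : ℝ) : ℂ) * I)) := by
      unfold sectorCentre
      rw [map_mul, ← Complex.exp_conj, map_mul, Complex.conj_ofReal, Complex.conj_ofReal, Complex.conj_I]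
      ring_nf
    have hnc : ‖sectorCentre θ‖ = 1 / 2 := by
      unfold sectorCentre
      rw [norm_mul, Complex.norm_exp_ofReal_mul_I, mul_one, Complex.norm_real, Real.norm_eq_abs]; norm_num
    rw [← Complex.normSq_eq_norm_sq, Complex.normSq_sub, Complex.normSq_eq_norm_sq, Complex.normSq_eq_norm_sq,
      hnz, hnc, hcc]
    have : (z * (((1 / 2 : ℝ) : ℂ) * cexp (-(((θ / 2 : ℝ) : ℂ) * I)))).re = 1 / 2 * u.re := by
      rw [hu, show z * (((1 / 2 : ℝ) : ℂ) * cexp (-(((θ / 2 : ℝ) : ℂ) * I))) =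
        ((1 / 2 : ℝ) : ℂ) * (z * cexp (-(((θ / 2 : ℝ) : ℂ) * I))) by ring, re_ofReal_mul]
    rw [this]; ring
  -- `Re(u²) ≤ |sin θ|`
  have hu2 : (u ^ 2).re ≤ |Real.sin θ| := by
    have he : cexp (-(((θ / 2 : ℝ) : ℂ) * I)) ^ 2 = (Real.cos θ : ℂ) - (Real.sin θ : ℂ) * I := by
      rw [← Complex.exp_nat_mul, show ((2 : ℕ) : ℂ) * -(((θ / 2 : ℝ) : ℂ) * I) = ((-θ : ℝ) : ℂ) * I by push_cast; ring,
        Complex.exp_mul_I, ← ofReal_cos, ← ofReal_sin, Real.cos_neg, Real.sin_neg]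
      push_cast; ring
    rw [hu, mul_pow, he]
    have hcos : 0 < Real.cos θ := Real.cos_pos_of_mem_Ioo ⟨by linarith [abs_lt.1 hθ], by linarith [abs_lt.1 hθ]⟩
    rcases hz2 with h | h | h <;> rw [h]
    · have : (I * ((Real.cos θ : ℂ) - (Real.sin θ : ℂ) * I)).re = Real.sin θ := by
        simp [Complex.mul_re, Complex.sin_ofReal_re, Complex.cos_ofReal_re]
      rw [this]; exact le_abs_self _
    · have : (-I * ((Real.cos θ : ℂ) - (Real.sin θ : ℂ) * I)).re = -Real.sin θ := by
        simp [Complex.mul_re, Complex.sin_ofReal_re, Complex.cos_ofReal_re]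
      rw [this]; exact neg_le_abs _
    · have : (-1 * ((Real.cos θ : ℂ) - (Real.sin θ : ℂ) * I)).re = -Real.cos θ := by
        simp [Complex.mul_re, Complex.sin_ofReal_re, Complex.cos_ofReal_re]
      rw [this]; linarith [abs_nonneg (Real.sin θ)]
  -- `Re(u)² = (1 + Re(u²))/2 ≤ (1 + |sin θ|)/2 = cos²(π/4 - |θ|/2)`
  have hre2 : u.re ^ 2 = (1 + (u ^ 2).re) / 2 := by
    have h1 : u.re ^ 2 + u.im ^ 2 = 1 := by
      have := Complex.normSq_eq_norm_sq u
      rw [hnu, one_pow, Complex.normSq_apply] at this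
      nlinarith
    have h2 : (u ^ 2).re = u.re ^ 2 - u.im ^ 2 := by rw [sq, Complex.mul_re]; ring
    rw [h2]; linarith
  have hcos2 : Real.cos (π / 4 - |θ| / 2) ^ 2 = (1 + |Real.sin θ|) / 2 := by
    rw [Real.cos_sq, show 2 * (π / 4 - |θ| / 2) = π / 2 - |θ| by ring, Real.cos_pi_div_two_sub,
      abs_sin_eq_sin_abs (by linarith [abs_nonneg θ])]
    ring
  have hcpos : 0 < Real.cos (π / 4 - |θ| / 2) :=
    Real.cos_pos_of_mem_Ioo ⟨by linarith [abs_nonneg θ], by linarith [abs_nonneg θ]⟩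
  have hre : u.re ≤ Real.cos (π / 4 - |θ| / 2) := by
    rcases le_or_gt u.re 0 with h | h
    · linarith
    · nlinarith [hre2, hcos2, hu2]
  have h2 := lt_sectorCosMid hθ
  rw [hdist, sectorRadSq]
  linarith


/-! ### The contour identity: `J = (ray) + (arc)` -/

/-- The radius `R = √(5/4 - c_m)` is positive. [folklore] -/
theorem sectorRadSq_pos {θ : ℝ} (hθ : |θ| < π / 4) : 0 < sectorRadSq θ := by
  unfold sectorRadSq; linarith [sectorCosMid_lt_one hθ]

/-- Points of the closed sector lie in the open ball `B(c, R)`. [folklore] -/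
theorem mem_ball_sectorCentre {θ : ℝ} (hθ : |θ| < π / 4) {ρ : ℝ} (hρ0 : 0 ≤ ρ) (hρ1 : ρ ≤ 1) {φ : ℝ}
    (hφ : φ ∈ uIcc θ 0) : (ρ : ℂ) * cexp ((φ : ℂ) * I) ∈ ball (sectorCentre θ) (Real.sqrt (sectorRadSq θ)) := by
  rw [mem_ball, dist_eq_norm]
  exact (Real.lt_sqrt (norm_nonneg _)).2 (dist_sq_lt_sectorRadSq hθ hρ0 hρ1 hφ)

/-- The ball `B(c, R)` contains no singular point. [folklore] -/
theorem not_mem_slitPoles_of_mem_ball {θ : ℝ} (hθ : |θ| < π / 4) {z : ℂ}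
    (hz : z ∈ ball (sectorCentre θ) (Real.sqrt (sectorRadSq θ))) : z ∉ slitPoles := by
  intro hp
  have h := sectorRadSq_le_dist_sq hθ hp
  rw [mem_ball, dist_eq_norm] at hz
  have := (Real.lt_sqrt (norm_nonneg _)).1 hz
  linarith

/-- `E^k Y^s A` is holomorphic on the ball `B(c, R)`. [folklore] -/
theorem differentiableOn_slitJc_ball (k : ℤ) (s : ℕ) {θ : ℝ} (hθ : |θ| < π / 4) :
    DifferentiableOn ℂ (slitJc k s) (ball (sectorCentre θ) (Real.sqrt (sectorRadSq θ))) := fun _ hz =>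
  (differentiableAt_slitJc k s (not_mem_slitPoles_of_mem_ball hθ hz)).differentiableWithinAt

/-- **Rotating the contour.** For `|θ| < π/4`,
`J(k, s) = e^{iθ} ∫_0^1 f(w e^{iθ}) dw + ∫_θ^0 f(e^{iφ}) i e^{iφ} dφ`, `f = E^k Y^s A`
(Cauchy's theorem for the sector, through a primitive of `f` on a ball containing it). [folklore] -/
theorem slitJ_eq_ray_add_arc (k : ℤ) (s : ℕ) {θ : ℝ} (hθ : |θ| < π / 4) :
    slitJ k s = cexp ((θ : ℂ) * I) * (∫ w in (0 : ℝ)..1, slitJc k s ((w : ℂ) * cexp ((θ : ℂ) * I))) +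
      ∫ φ in θ..0, slitJc k s (cexp ((φ : ℂ) * I)) * (cexp ((φ : ℂ) * I) * I) := by
  set c := sectorCentre θ with hc
  set R := Real.sqrt (sectorRadSq θ) with hR
  have hdiff := differentiableOn_slitJc_ball k s hθ
  obtain ⟨g, hg⟩ := hdiff.isExactOn_ball
  have hcont : ContinuousOn (slitJc k s) (ball c R) := hdiff.continuousOn
  have hθmem : θ ∈ uIcc θ 0 := left_mem_uIcc
  have h0mem : (0 : ℝ) ∈ uIcc θ 0 := right_mem_uIcc
  -- (1) the segment `[0, 1]`
  have hseg_mem : ∀ t ∈ uIcc (0 : ℝ) 1, (t : ℂ) ∈ ball c R := by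
    intro t ht
    rw [uIcc_of_le zero_le_one] at ht
    have h := mem_ball_sectorCentre hθ ht.1 ht.2 h0mem
    simpa using h
  have hseg : ∫ t in (0 : ℝ)..1, slitJc k s (t : ℂ) = g 1 - g 0 := by
    have hd : ∀ t ∈ uIcc (0 : ℝ) 1, HasDerivAt (fun x : ℝ => g (x : ℂ)) (slitJc k s (t : ℂ)) t := by
      intro t ht
      have h := (hg _ (hseg_mem t ht)).comp t ((hasDerivAt_id t).ofReal_comp)
      rw [ofReal_one, mul_one] at h
      exact h
    have h := intervalIntegral.integral_eq_sub_of_hasDerivAt hd ?_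
    · simpa using h
    · refine (Continuous.intervalIntegrable ?_ _ _)
      have : (fun t : ℝ => slitJc k s (t : ℂ)) = slitJFun k s := by funext t; exact slitJc_ofReal k s t
      rw [this]; exact continuous_slitJFun k s
  -- (2) the ray `w ↦ w e^{iθ}`
  have hray_mem : ∀ w ∈ uIcc (0 : ℝ) 1, (w : ℂ) * cexp ((θ : ℂ) * I) ∈ ball c R := by
    intro w hw
    rw [uIcc_of_le zero_le_one] at hw
    exact mem_ball_sectorCentre hθ hw.1 hw.2 hθmem
  have hray : ∫ w in (0 : ℝ)..1, slitJc k s ((w : ℂ) * cexp ((θ : ℂ) * I)) * cexp ((θ : ℂ) * I) =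
      g (cexp ((θ : ℂ) * I)) - g 0 := by
    have hd : ∀ w ∈ uIcc (0 : ℝ) 1, HasDerivAt (fun x : ℝ => g ((x : ℂ) * cexp ((θ : ℂ) * I)))
        (slitJc k s ((w : ℂ) * cexp ((θ : ℂ) * I)) * cexp ((θ : ℂ) * I)) w := by
      intro w hw
      have h := (hg _ (hray_mem w hw)).comp w (((hasDerivAt_id w).ofReal_comp).mul_const (cexp ((θ : ℂ) * I)))
      rw [ofReal_one, one_mul] at h
      exact h
    have h := intervalIntegral.integral_eq_sub_of_hasDerivAt hd ?_
    · simpa using h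
    · refine ContinuousOn.intervalIntegrable ?_
      refine ContinuousOn.mul ?_ continuousOn_const
      exact hcont.comp (Continuous.continuousOn (by fun_prop)) fun w hw => hray_mem w hw
  -- (3) the arc `φ ↦ e^{iφ}`
  have harc_mem : ∀ φ ∈ uIcc θ 0, cexp ((φ : ℂ) * I) ∈ ball c R := by
    intro φ hφ
    have h := mem_ball_sectorCentre hθ zero_le_one le_rfl hφ
    simpa using h
  have harc : ∫ φ in θ..0, slitJc k s (cexp ((φ : ℂ) * I)) * (cexp ((φ : ℂ) * I) * I) = g 1 - g (cexp ((θ : ℂ) * I)) := by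
    have hd : ∀ φ ∈ uIcc θ 0, HasDerivAt (fun x : ℝ => g (cexp ((x : ℂ) * I)))
        (slitJc k s (cexp ((φ : ℂ) * I)) * (cexp ((φ : ℂ) * I) * I)) φ := fun φ hφ =>
      (hg _ (harc_mem φ hφ)).comp φ (hasDerivAt_cexp_mul_I φ)
    have h := intervalIntegral.integral_eq_sub_of_hasDerivAt hd ?_
    · simpa using h
    · refine ContinuousOn.intervalIntegrable ?_
      refine ContinuousOn.mul ?_ (Continuous.continuousOn (by fun_prop))
      exact hcont.comp (Continuous.continuousOn (by fun_prop)) fun φ hφ => harc_mem φ hφ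
  -- assemble
  have hJ : slitJ k s = ∫ t in (0 : ℝ)..1, slitJc k s (t : ℂ) := by
    rw [slitJ]; exact intervalIntegral.integral_congr fun t _ => (slitJc_ofReal k s t).symm
  rw [hJ, hseg]
  rw [intervalIntegral.integral_mul_const] at hray
  linear_combination (-1 : ℂ) * hray - harc


/-! ### Moduli on the ray `v = w e^{iθ}` and on the arc `v = e^{iφ}` -/

/-- `(w e^{iθ})² = w²(cos 2θ + i sin 2θ)`. [folklore] -/
theorem ray_sq (w θ : ℝ) : ((w : ℂ) * cexp ((θ : ℂ) * I)) ^ 2 =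
    ((w ^ 2 * Real.cos (2 * θ) : ℝ) : ℂ) + ((w ^ 2 * Real.sin (2 * θ) : ℝ) : ℂ) * I := by
  rw [mul_pow, ← Complex.exp_nat_mul, show ((2 : ℕ) : ℂ) * ((θ : ℂ) * I) = ((2 * θ : ℝ) : ℂ) * I by push_cast; ring,
    Complex.exp_mul_I, ← ofReal_cos, ← ofReal_sin]
  push_cast; ring

/-- `‖1 - i(we^{iθ})²‖² = 1 + 2w² sin 2θ + w⁴`. [folklore] -/
theorem normSq_one_sub_I_ray (w θ : ℝ) :
    ‖(1 : ℂ) - I * ((w : ℂ) * cexp ((θ : ℂ) * I)) ^ 2‖ ^ 2 = 1 + 2 * w ^ 2 * Real.sin (2 * θ) + w ^ 4 := by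
  rw [ray_sq, show (1 : ℂ) - I * (((w ^ 2 * Real.cos (2 * θ) : ℝ) : ℂ) + ((w ^ 2 * Real.sin (2 * θ) : ℝ) : ℂ) * I) =
      ((1 + w ^ 2 * Real.sin (2 * θ) : ℝ) : ℂ) + ((-(w ^ 2 * Real.cos (2 * θ)) : ℝ) : ℂ) * I by
    push_cast; ring_nf; rw [Complex.I_sq]; ring,
    ← Complex.normSq_eq_norm_sq, normSq_add_mul_I]
  linear_combination w ^ 4 * Real.sin_sq_add_cos_sq (2 * θ)

/-- `‖1 + i(we^{iθ})²‖² = 1 - 2w² sin 2θ + w⁴`. [folklore] -/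
theorem normSq_one_add_I_ray (w θ : ℝ) :
    ‖(1 : ℂ) + I * ((w : ℂ) * cexp ((θ : ℂ) * I)) ^ 2‖ ^ 2 = 1 - 2 * w ^ 2 * Real.sin (2 * θ) + w ^ 4 := by
  rw [ray_sq, show (1 : ℂ) + I * (((w ^ 2 * Real.cos (2 * θ) : ℝ) : ℂ) + ((w ^ 2 * Real.sin (2 * θ) : ℝ) : ℂ) * I) =
      ((1 - w ^ 2 * Real.sin (2 * θ) : ℝ) : ℂ) + ((w ^ 2 * Real.cos (2 * θ) : ℝ) : ℂ) * I by
    push_cast; ring_nf; rw [Complex.I_sq]; ring,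
    ← Complex.normSq_eq_norm_sq, normSq_add_mul_I]
  linear_combination w ^ 4 * Real.sin_sq_add_cos_sq (2 * θ)

/-- `‖1 - (we^{iθ})²‖² = 1 - 2w² cos 2θ + w⁴`. [folklore] -/
theorem normSq_one_sub_ray (w θ : ℝ) :
    ‖(1 : ℂ) - ((w : ℂ) * cexp ((θ : ℂ) * I)) ^ 2‖ ^ 2 = 1 - 2 * w ^ 2 * Real.cos (2 * θ) + w ^ 4 := by
  rw [ray_sq, show (1 : ℂ) - (((w ^ 2 * Real.cos (2 * θ) : ℝ) : ℂ) + ((w ^ 2 * Real.sin (2 * θ) : ℝ) : ℂ) * I) =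
      ((1 - w ^ 2 * Real.cos (2 * θ) : ℝ) : ℂ) + ((-(w ^ 2 * Real.sin (2 * θ)) : ℝ) : ℂ) * I by push_cast; ring,
    ← Complex.normSq_eq_norm_sq, normSq_add_mul_I]
  linear_combination w ^ 4 * Real.sin_sq_add_cos_sq (2 * θ)

/-- `‖1 + (we^{iθ})²‖² = 1 + 2w² cos 2θ + w⁴`. [folklore] -/
theorem normSq_one_add_ray (w θ : ℝ) :
    ‖(1 : ℂ) + ((w : ℂ) * cexp ((θ : ℂ) * I)) ^ 2‖ ^ 2 = 1 + 2 * w ^ 2 * Real.cos (2 * θ) + w ^ 4 := by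
  rw [ray_sq, show (1 : ℂ) + (((w ^ 2 * Real.cos (2 * θ) : ℝ) : ℂ) + ((w ^ 2 * Real.sin (2 * θ) : ℝ) : ℂ) * I) =
      ((1 + w ^ 2 * Real.cos (2 * θ) : ℝ) : ℂ) + ((w ^ 2 * Real.sin (2 * θ) : ℝ) : ℂ) * I by push_cast; ring,
    ← Complex.normSq_eq_norm_sq, normSq_add_mul_I]
  linear_combination w ^ 4 * Real.sin_sq_add_cos_sq (2 * θ)

/-- `2w² ≤ 1 + w⁴`. [folklore] -/
theorem two_mul_sq_le (w : ℝ) : 2 * w ^ 2 ≤ 1 + w ^ 4 := by nlinarith [sq_nonneg (w ^ 2 - 1)]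

/-- The elementary inequality `(p - q)/(p + q) ≤ exp(-q/p)` for `0 ≤ q ≤ p`, `0 < p`. [folklore] -/
theorem sub_div_add_le_exp {p q : ℝ} (hp : 0 < p) (hq : 0 ≤ q) (hqp : q ≤ p) :
    (p - q) / (p + q) ≤ Real.exp (-(q / p)) := by
  have h1 : (p - q) / (p + q) ≤ (p - q) / p := div_le_div_of_nonneg_left (by linarith) hp (by linarith)
  have h2 : (p - q) / p = 1 - q / p := by field_simp
  rw [h2] at h1
  exact h1.trans (by have := Real.one_sub_le_exp_neg (q / p); linarith)

/-- **Decay of `E^k` along the ray**: if `k sin 2θ ≤ 0` then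
`‖E(we^{iθ})^k‖ ≤ exp(-|k| w² |sin 2θ|/(1 + w⁴))`. [folklore] -/
theorem norm_slitEc_zpow_ray_le (k : ℤ) {w θ : ℝ} (hk : (k : ℝ) * Real.sin (2 * θ) ≤ 0) :
    ‖slitEc ((w : ℂ) * cexp ((θ : ℂ) * I)) ^ k‖ ≤
      Real.exp (-(|(k : ℝ)| * (w ^ 2 * |Real.sin (2 * θ)|) / (1 + w ^ 4))) := by
  set P := 1 + w ^ 4 with hP
  set Q := 2 * w ^ 2 * |Real.sin (2 * θ)| with hQ
  have hPpos : 0 < P := by positivity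
  have hQ0 : 0 ≤ Q := by positivity
  have hQP : Q ≤ P := by
    rw [hQ, hP]
    calc 2 * w ^ 2 * |Real.sin (2 * θ)| ≤ 2 * w ^ 2 * 1 := by gcongr; exact Real.abs_sin_le_one _
      _ ≤ 1 + w ^ 4 := by linarith [two_mul_sq_le w]
  have hsum : ‖(1 : ℂ) - I * ((w : ℂ) * cexp ((θ : ℂ) * I)) ^ 2‖ ^ 2 + ‖(1 : ℂ) + I * ((w : ℂ) * cexp ((θ : ℂ) * I)) ^ 2‖ ^ 2 =
      2 * P := by rw [normSq_one_sub_I_ray, normSq_one_add_I_ray, hP]; ring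
  -- the key bound on the relevant ratio `(P - Q)/(P + Q)`
  have key : ∀ {num den : ℝ}, num = P - Q → den = P + Q → 0 ≤ num → 0 < den →
      Real.sqrt (num / den) ≤ Real.exp (-(Q / (2 * P))) := by
    intro num den hn hd hn0 hd0
    rw [Real.sqrt_le_left (Real.exp_pos _).le, ← Real.exp_nat_mul, hn, hd]
    refine (sub_div_add_le_exp hPpos hQ0 hQP).trans (le_of_eq ?_)
    congr 1; push_cast; field_simp
  have hexp : Real.exp (-(Q / (2 * P))) ^ k.natAbs = Real.exp (-(|(k : ℝ)| * (w ^ 2 * |Real.sin (2 * θ)|) / (1 + w ^ 4))) := by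
    rw [← Real.exp_nat_mul, Nat.cast_natAbs, Int.cast_abs, hQ, hP]
    congr 1; field_simp
  rcases lt_trichotomy k 0 with hk0 | rfl | hk0
  rotate_left
  · -- `k = 0`
    simp
  · -- `k > 0`: `sin 2θ ≤ 0`, `‖E‖² = (P - Q)/(P + Q)`
    have hs : Real.sin (2 * θ) ≤ 0 := by
      have : (0 : ℝ) < k := by exact_mod_cast hk0
      by_contra hcon
      have : 0 < (k : ℝ) * Real.sin (2 * θ) := mul_pos this (lt_of_not_ge hcon)
      linarith
    have hk0' : 0 ≤ k := hk0.le
    have habs : |Real.sin (2 * θ)| = -Real.sin (2 * θ) := abs_of_nonpos hs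
    have hden : 0 < ‖(1 : ℂ) + I * ((w : ℂ) * cexp ((θ : ℂ) * I)) ^ 2‖ := by
      have h2 : ‖(1 : ℂ) + I * ((w : ℂ) * cexp ((θ : ℂ) * I)) ^ 2‖ ^ 2 = P + Q := by
        rw [normSq_one_add_I_ray, hP, hQ, habs]; ring
      nlinarith [norm_nonneg ((1 : ℂ) + I * ((w : ℂ) * cexp ((θ : ℂ) * I)) ^ 2)]
    have hE : ‖slitEc ((w : ℂ) * cexp ((θ : ℂ) * I))‖ = Real.sqrt ((P - Q) / (P + Q)) := by
      rw [slitEc, norm_div, Real.sqrt_div' , ← Real.sqrt_sq (norm_nonneg (1 - _)), ← Real.sqrt_sq hden.le,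
        normSq_one_sub_I_ray, normSq_one_add_I_ray, hP, hQ, habs]
      · ring_nf
      · nlinarith
    obtain ⟨n, rfl⟩ := Int.eq_ofNat_of_zero_le hk0'
    rw [zpow_natCast, norm_pow, hE]
    rw [show ((n : ℤ)).natAbs = n from rfl] at hexp
    rw [← hexp]
    exact pow_le_pow_left₀ (Real.sqrt_nonneg _) (key rfl rfl (by linarith) (by linarith)) n
  · -- `k < 0`: `sin 2θ ≥ 0`, `‖E⁻¹‖² = (P - Q)/(P + Q)`
    have hs : 0 ≤ Real.sin (2 * θ) := by
      have : (k : ℝ) < 0 := by exact_mod_cast hk0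
      by_contra hcon
      have : 0 < (k : ℝ) * Real.sin (2 * θ) := mul_pos_of_neg_of_neg this (lt_of_not_ge hcon)
      linarith
    have habs : |Real.sin (2 * θ)| = Real.sin (2 * θ) := abs_of_nonneg hs
    have hnum : 0 < ‖(1 : ℂ) - I * ((w : ℂ) * cexp ((θ : ℂ) * I)) ^ 2‖ := by
      have h2 : ‖(1 : ℂ) - I * ((w : ℂ) * cexp ((θ : ℂ) * I)) ^ 2‖ ^ 2 = P + Q := by
        rw [normSq_one_sub_I_ray, hP, hQ, habs]; ring
      nlinarith [norm_nonneg ((1 : ℂ) - I * ((w : ℂ) * cexp ((θ : ℂ) * I)) ^ 2)]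
    have hE : ‖(slitEc ((w : ℂ) * cexp ((θ : ℂ) * I)))⁻¹‖ = Real.sqrt ((P - Q) / (P + Q)) := by
      rw [slitEc, inv_div, norm_div, Real.sqrt_div', ← Real.sqrt_sq (norm_nonneg (1 + _)), ← Real.sqrt_sq hnum.le,
        normSq_one_sub_I_ray, normSq_one_add_I_ray, hP, hQ, habs]
      · ring_nf
      · nlinarith
    obtain ⟨n, hn⟩ : ∃ n : ℕ, k = -(n : ℤ) := ⟨k.natAbs, by omega⟩
    rw [hn, zpow_neg, zpow_natCast, ← inv_pow, norm_pow, hE]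
    have : (-(n : ℤ)).natAbs = n := by simp
    rw [hn, this] at hexp
    rw [← hexp]
    exact pow_le_pow_left₀ (Real.sqrt_nonneg _) (key rfl rfl (by linarith) (by linarith)) n


/-- **Decay of `Y^s` along the ray**: if `cos 2θ ≥ 0` then `‖Y(we^{iθ})^s‖ ≤ exp(-s w² cos 2θ/(1 + w⁴))`. [folklore] -/
theorem norm_slitYc_pow_ray_le (s : ℕ) {w θ : ℝ} (hc : 0 ≤ Real.cos (2 * θ)) :
    ‖slitYc ((w : ℂ) * cexp ((θ : ℂ) * I)) ^ s‖ ≤ Real.exp (-((s : ℝ) * (w ^ 2 * Real.cos (2 * θ)) / (1 + w ^ 4))) := by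
  set P := 1 + w ^ 4 with hP
  set Q := 2 * w ^ 2 * Real.cos (2 * θ) with hQ
  have hPpos : 0 < P := by positivity
  have hQ0 : 0 ≤ Q := by positivity
  have hQP : Q ≤ P := by
    rw [hQ, hP]
    calc 2 * w ^ 2 * Real.cos (2 * θ) ≤ 2 * w ^ 2 * 1 := by gcongr; exact Real.cos_le_one _
      _ ≤ 1 + w ^ 4 := by linarith [two_mul_sq_le w]
  have hden : 0 < ‖(1 : ℂ) + ((w : ℂ) * cexp ((θ : ℂ) * I)) ^ 2‖ := by
    have h2 : ‖(1 : ℂ) + ((w : ℂ) * cexp ((θ : ℂ) * I)) ^ 2‖ ^ 2 = P + Q := by rw [normSq_one_add_ray, hP, hQ]; ring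
    nlinarith [norm_nonneg ((1 : ℂ) + ((w : ℂ) * cexp ((θ : ℂ) * I)) ^ 2)]
  have hY : ‖slitYc ((w : ℂ) * cexp ((θ : ℂ) * I))‖ = Real.sqrt ((P - Q) / (P + Q)) := by
    rw [slitYc, norm_div, Real.sqrt_div', ← Real.sqrt_sq (norm_nonneg (1 - _)), ← Real.sqrt_sq hden.le,
      normSq_one_sub_ray, normSq_one_add_ray, hP, hQ]
    · ring_nf
    · nlinarith
  have key : Real.sqrt ((P - Q) / (P + Q)) ≤ Real.exp (-(Q / (2 * P))) := by
    rw [Real.sqrt_le_left (Real.exp_pos _).le, ← Real.exp_nat_mul]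
    refine (sub_div_add_le_exp hPpos hQ0 hQP).trans (le_of_eq ?_)
    congr 1; push_cast; field_simp
  rw [norm_pow, hY]
  refine (pow_le_pow_left₀ (Real.sqrt_nonneg _) key s).trans (le_of_eq ?_)
  rw [← Real.exp_nat_mul, hQ, hP]
  congr 1; field_simp

/-! ### The rotation angle `θ_a = -arg(a)/2` for `a = s + ik`, `s ≥ 1` -/

/-- The parameter `a = s + ik`. [folklore] -/
def slitParam (k : ℤ) (s : ℕ) : ℂ := (s : ℂ) + (k : ℂ) * I

/-- The rotation angle `θ_a = -arg(a)/2`. [folklore] -/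
def rotAngle (k : ℤ) (s : ℕ) : ℝ := -(slitParam k s).arg / 2

/-- `Re a = s`, `Im a = k`. [folklore] -/
theorem slitParam_re (k : ℤ) (s : ℕ) : (slitParam k s).re = s := by simp [slitParam]

/-- `Im a = k`. [folklore] -/
theorem slitParam_im (k : ℤ) (s : ℕ) : (slitParam k s).im = k := by simp [slitParam]

/-- `a ≠ 0` and `‖a‖ ≥ 1` for `s ≥ 1`. [folklore] -/
theorem one_le_norm_slitParam (k : ℤ) {s : ℕ} (hs : 1 ≤ s) : 1 ≤ ‖slitParam k s‖ := by
  have h : (1 : ℝ) ≤ |(slitParam k s).re| := by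
    rw [slitParam_re]; rw [abs_of_nonneg (by positivity)]; exact_mod_cast hs
  exact h.trans (abs_re_le_norm _)

/-- `a ≠ 0`. [folklore] -/
theorem slitParam_ne_zero (k : ℤ) {s : ℕ} (hs : 1 ≤ s) : slitParam k s ≠ 0 := by
  intro h; have := one_le_norm_slitParam k hs; rw [h, norm_zero] at this; linarith

/-- `‖a‖² = s² + k²`. [folklore] -/
theorem norm_slitParam_sq (k : ℤ) (s : ℕ) : ‖slitParam k s‖ ^ 2 = (s : ℝ) ^ 2 + (k : ℝ) ^ 2 := by
  rw [← Complex.normSq_eq_norm_sq, slitParam, show ((s : ℂ) + (k : ℂ) * I) = ((s : ℝ) : ℂ) + ((k : ℝ) : ℂ) * I by norm_cast,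
    normSq_add_mul_I]

/-- `|arg a| < π/2` (since `Re a > 0`), hence `|θ_a| < π/4`. [folklore] -/
theorem abs_rotAngle_lt (k : ℤ) {s : ℕ} (hs : 1 ≤ s) : |rotAngle k s| < π / 4 := by
  have h : |(slitParam k s).arg| < π / 2 :=
    Complex.abs_arg_lt_pi_div_two_iff.2 (Or.inl (by rw [slitParam_re]; exact_mod_cast hs))
  rw [rotAngle, abs_div, abs_neg, abs_two]
  linarith

/-- `sin 2θ_a = -k/‖a‖`. [folklore] -/
theorem sin_two_mul_rotAngle (k : ℤ) (s : ℕ) : Real.sin (2 * rotAngle k s) = -(k : ℝ) / ‖slitParam k s‖ := by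
  rw [rotAngle, show 2 * (-(slitParam k s).arg / 2) = -(slitParam k s).arg by ring, Real.sin_neg, Complex.sin_arg,
    slitParam_im, neg_div]

/-- `cos 2θ_a = s/‖a‖`. [folklore] -/
theorem cos_two_mul_rotAngle (k : ℤ) {s : ℕ} (hs : 1 ≤ s) : Real.cos (2 * rotAngle k s) = (s : ℝ) / ‖slitParam k s‖ := by
  rw [rotAngle, show 2 * (-(slitParam k s).arg / 2) = -(slitParam k s).arg by ring, Real.cos_neg,
    Complex.cos_arg (slitParam_ne_zero k hs), slitParam_re]

/-- **Gaussian decay of `E^k Y^s` along the rotated ray**: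
`‖E(v)^k Y(v)^s‖ ≤ exp(-‖a‖ w²/(1 + w⁴))`, `v = w e^{iθ_a}`. [folklore] -/
theorem norm_slitEc_zpow_mul_slitYc_pow_le (k : ℤ) {s : ℕ} (hs : 1 ≤ s) (w : ℝ) :
    ‖slitEc ((w : ℂ) * cexp ((rotAngle k s : ℂ) * I)) ^ k * slitYc ((w : ℂ) * cexp ((rotAngle k s : ℂ) * I)) ^ s‖ ≤
      Real.exp (-(‖slitParam k s‖ * w ^ 2 / (1 + w ^ 4))) := by
  have hn : 0 < ‖slitParam k s‖ := by linarith [one_le_norm_slitParam k hs]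
  have hsin := sin_two_mul_rotAngle k s
  have hcos := cos_two_mul_rotAngle k hs
  have hk : (k : ℝ) * Real.sin (2 * rotAngle k s) ≤ 0 := by
    rw [hsin, show (k : ℝ) * (-(k : ℝ) / ‖slitParam k s‖) = -((k : ℝ) ^ 2 / ‖slitParam k s‖) by ring]
    have : 0 ≤ (k : ℝ) ^ 2 / ‖slitParam k s‖ := by positivity
    linarith
  have hc : 0 ≤ Real.cos (2 * rotAngle k s) := by rw [hcos]; positivity
  have h1 := norm_slitEc_zpow_ray_le k (w := w) hk
  have h2 := norm_slitYc_pow_ray_le s (w := w) hc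
  rw [norm_mul]
  refine (mul_le_mul h1 h2 (norm_nonneg _) (Real.exp_pos _).le).trans (le_of_eq ?_)
  rw [← Real.exp_add, hsin, hcos, abs_div, abs_neg, abs_of_pos hn]
  congr 1
  have hsq := norm_slitParam_sq k s
  have hkk : |(k : ℝ)| * |(k : ℝ)| = (k : ℝ) ^ 2 := by rw [← sq, sq_abs]
  field_simp
  nlinarith [hkk, hsq]


/-! ### Taylor expansion at the origin: `E^k Y^s = exp(-2 a v² + R)`, `‖R‖ ≤ 2‖a‖ ‖v‖⁶` -/

/-- `L_E(v) = log(1 - iv²) - log(1 + iv²)`. [folklore] -/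
def logE (v : ℂ) : ℂ := Complex.log (1 - I * v ^ 2) - Complex.log (1 + I * v ^ 2)

/-- `L_Y(v) = log(1 - v²) - log(1 + v²)`. [folklore] -/
def logY (v : ℂ) : ℂ := Complex.log (1 - v ^ 2) - Complex.log (1 + v ^ 2)

/-- `‖iv²‖ = ‖v‖²`, `‖v²‖ = ‖v‖²`. [folklore] -/
theorem norm_I_mul_sq (v : ℂ) : ‖I * v ^ 2‖ = ‖v‖ ^ 2 := by rw [norm_mul, Complex.norm_I, one_mul, norm_pow]

/-- For `‖v‖ < 1`: `exp(L_E v) = E(v)`. [folklore] -/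
theorem exp_logE {v : ℂ} (hv : ‖v‖ < 1) : cexp (logE v) = slitEc v := by
  have hv2 : ‖v‖ ^ 2 < 1 := by nlinarith [norm_nonneg v]
  have h1 : (1 : ℂ) - I * v ^ 2 ≠ 0 := by
    intro h; have : ‖I * v ^ 2‖ = 1 := by rw [← sub_eq_zero.1 h, norm_one]
    rw [norm_I_mul_sq] at this; linarith
  have h2 : (1 : ℂ) + I * v ^ 2 ≠ 0 := by
    intro h; have : ‖I * v ^ 2‖ = 1 := by rw [show I * v ^ 2 = -1 by linear_combination h, norm_neg, norm_one]
    rw [norm_I_mul_sq] at this; linarith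
  rw [logE, Complex.exp_sub, Complex.exp_log h1, Complex.exp_log h2, slitEc]

/-- For `‖v‖ < 1`: `exp(L_Y v) = Y(v)`. [folklore] -/
theorem exp_logY {v : ℂ} (hv : ‖v‖ < 1) : cexp (logY v) = slitYc v := by
  have hv2 : ‖v‖ ^ 2 < 1 := by nlinarith [norm_nonneg v]
  have h1 : (1 : ℂ) - v ^ 2 ≠ 0 := by
    intro h; have : ‖v ^ 2‖ = 1 := by rw [← sub_eq_zero.1 h, norm_one]
    rw [norm_pow] at this; linarith
  have h2 : (1 : ℂ) + v ^ 2 ≠ 0 := by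
    intro h; have : ‖v ^ 2‖ = 1 := by rw [show v ^ 2 = -1 by linear_combination h, norm_neg, norm_one]
    rw [norm_pow] at this; linarith
  rw [logY, Complex.exp_sub, Complex.exp_log h1, Complex.exp_log h2, slitYc]

/-- The cubic Taylor bound for `log(1 + z)`: `‖log(1+z) - (z - z²/2)‖ ≤ ‖z‖³/(3(1 - ‖z‖))`. [folklore] -/
theorem norm_log_one_add_sub_le {z : ℂ} (hz : ‖z‖ < 1) :
    ‖Complex.log (1 + z) - (z - z ^ 2 / 2)‖ ≤ ‖z‖ ^ 3 * (1 - ‖z‖)⁻¹ / 3 := by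
  have h := Complex.norm_log_sub_logTaylor_le 2 hz
  have ht : Complex.logTaylor 3 z = z - z ^ 2 / 2 := by
    simp [Complex.logTaylor, Finset.sum_range_succ]
    ring
  rw [ht] at h
  norm_num at h
  exact h

/-- **`‖L_E(v) + 2iv²‖ ≤ ‖v‖⁶`** for `‖v‖² ≤ 1/3` (the quadratic Taylor terms cancel). [folklore] -/
theorem norm_logE_add_le {v : ℂ} (hv : ‖v‖ ^ 2 ≤ 1 / 3) : ‖logE v + 2 * I * v ^ 2‖ ≤ ‖v‖ ^ 6 := by
  have hz : ‖I * v ^ 2‖ < 1 := by rw [norm_I_mul_sq]; linarith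
  have hz' : ‖-(I * v ^ 2)‖ < 1 := by rwa [norm_neg]
  have h1 := norm_log_one_add_sub_le hz'
  have h2 := norm_log_one_add_sub_le hz
  rw [norm_neg, norm_I_mul_sq] at h1
  rw [norm_I_mul_sq] at h2
  have key : logE v + 2 * I * v ^ 2 =
      (Complex.log (1 + -(I * v ^ 2)) - (-(I * v ^ 2) - (-(I * v ^ 2)) ^ 2 / 2)) -
        (Complex.log (1 + I * v ^ 2) - (I * v ^ 2 - (I * v ^ 2) ^ 2 / 2)) := by
    rw [logE, show (1 : ℂ) + -(I * v ^ 2) = 1 - I * v ^ 2 by ring]; ring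
  rw [key]
  refine (norm_sub_le _ _).trans ?_
  have hb : (‖v‖ ^ 2) ^ 3 * (1 - ‖v‖ ^ 2)⁻¹ / 3 ≤ ‖v‖ ^ 6 / 2 := by
    rw [show (‖v‖ ^ 2) ^ 3 = ‖v‖ ^ 6 by ring]
    have h3 : (1 - ‖v‖ ^ 2)⁻¹ ≤ 3 / 2 := by
      rw [inv_le_comm₀ (by linarith) (by norm_num)]; linarith
    have h6 : 0 ≤ ‖v‖ ^ 6 := by positivity
    calc ‖v‖ ^ 6 * (1 - ‖v‖ ^ 2)⁻¹ / 3 ≤ ‖v‖ ^ 6 * (3 / 2) / 3 := by gcongr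
      _ = ‖v‖ ^ 6 / 2 := by ring
  linarith

/-- **`‖L_Y(v) + 2v²‖ ≤ ‖v‖⁶`** for `‖v‖² ≤ 1/3`. [folklore] -/
theorem norm_logY_add_le {v : ℂ} (hv : ‖v‖ ^ 2 ≤ 1 / 3) : ‖logY v + 2 * v ^ 2‖ ≤ ‖v‖ ^ 6 := by
  have hz : ‖v ^ 2‖ < 1 := by rw [norm_pow]; linarith
  have hz' : ‖-(v ^ 2)‖ < 1 := by rwa [norm_neg]
  have h1 := norm_log_one_add_sub_le hz'
  have h2 := norm_log_one_add_sub_le hz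
  rw [norm_neg, norm_pow] at h1
  rw [norm_pow] at h2
  have key : logY v + 2 * v ^ 2 =
      (Complex.log (1 + -(v ^ 2)) - (-(v ^ 2) - (-(v ^ 2)) ^ 2 / 2)) -
        (Complex.log (1 + v ^ 2) - (v ^ 2 - (v ^ 2) ^ 2 / 2)) := by
    rw [logY, show (1 : ℂ) + -(v ^ 2) = 1 - v ^ 2 by ring]; ring
  rw [key]
  refine (norm_sub_le _ _).trans ?_
  have hb : (‖v‖ ^ 2) ^ 3 * (1 - ‖v‖ ^ 2)⁻¹ / 3 ≤ ‖v‖ ^ 6 / 2 := by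
    rw [show (‖v‖ ^ 2) ^ 3 = ‖v‖ ^ 6 by ring]
    have h3 : (1 - ‖v‖ ^ 2)⁻¹ ≤ 3 / 2 := by
      rw [inv_le_comm₀ (by linarith) (by norm_num)]; linarith
    have h6 : 0 ≤ ‖v‖ ^ 6 := by positivity
    calc ‖v‖ ^ 6 * (1 - ‖v‖ ^ 2)⁻¹ / 3 ≤ ‖v‖ ^ 6 * (3 / 2) / 3 := by gcongr
      _ = ‖v‖ ^ 6 / 2 := by ring
  linarith

/-- **`E^k Y^s = exp(k L_E + s L_Y)`** for `‖v‖ < 1`. [folklore] -/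
theorem slitEc_zpow_mul_slitYc_pow_eq_exp (k : ℤ) (s : ℕ) {v : ℂ} (hv : ‖v‖ < 1) :
    slitEc v ^ k * slitYc v ^ s = cexp ((k : ℂ) * logE v + (s : ℂ) * logY v) := by
  rw [Complex.exp_add, Complex.exp_int_mul, Complex.exp_nat_mul, exp_logE hv, exp_logY hv]

/-- **The remainder bound**: `‖(k L_E + s L_Y) + 2 a v²‖ ≤ (|k| + s) ‖v‖⁶` for `‖v‖² ≤ 1/3`. [folklore] -/
theorem norm_phase_remainder_le (k : ℤ) (s : ℕ) {v : ℂ} (hv : ‖v‖ ^ 2 ≤ 1 / 3) :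
    ‖(k : ℂ) * logE v + (s : ℂ) * logY v + 2 * slitParam k s * v ^ 2‖ ≤ (|(k : ℝ)| + s) * ‖v‖ ^ 6 := by
  have h1 := norm_logE_add_le hv
  have h2 := norm_logY_add_le hv
  have key : (k : ℂ) * logE v + (s : ℂ) * logY v + 2 * slitParam k s * v ^ 2 =
      (k : ℂ) * (logE v + 2 * I * v ^ 2) + (s : ℂ) * (logY v + 2 * v ^ 2) := by
    rw [slitParam]; ring
  rw [key]
  refine (norm_add_le _ _).trans ?_
  rw [norm_mul, norm_mul, Complex.norm_intCast, Complex.norm_natCast, add_mul]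
  exact add_le_add (mul_le_mul_of_nonneg_left h1 (abs_nonneg _)) (mul_le_mul_of_nonneg_left h2 (Nat.cast_nonneg _))

/-- `|k| + s ≤ 2‖a‖`. [folklore] -/
theorem abs_add_le_two_mul_norm (k : ℤ) (s : ℕ) : |(k : ℝ)| + s ≤ 2 * ‖slitParam k s‖ := by
  have h1 : |(k : ℝ)| ≤ ‖slitParam k s‖ := by rw [← slitParam_im k s]; exact abs_im_le_norm _
  have h2 : (s : ℝ) ≤ ‖slitParam k s‖ := by
    have := abs_re_le_norm (slitParam k s); rw [slitParam_re] at this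
    exact (le_abs_self _).trans this
  linarith

/-- **On the rotated ray the model phase is real**: `a (w e^{iθ_a})² = ‖a‖ w²`. [folklore] -/
theorem slitParam_mul_ray_sq (k : ℤ) (s : ℕ) (w : ℝ) :
    slitParam k s * ((w : ℂ) * cexp ((rotAngle k s : ℂ) * I)) ^ 2 = ((‖slitParam k s‖ * w ^ 2 : ℝ) : ℂ) := by
  have ha := Complex.norm_mul_exp_arg_mul_I (slitParam k s)
  rw [mul_pow, ← Complex.exp_nat_mul, rotAngle,
    show ((2 : ℕ) : ℂ) * (((-(slitParam k s).arg / 2 : ℝ) : ℂ) * I) = -((slitParam k s).arg * I) by push_cast; ring,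
    Complex.exp_neg]
  have hne : cexp ((slitParam k s).arg * I) ≠ 0 := Complex.exp_ne_zero _
  rw [show slitParam k s * ((w : ℂ) ^ 2 * (cexp ((slitParam k s).arg * I))⁻¹) =
    (w : ℂ) ^ 2 * (slitParam k s * (cexp ((slitParam k s).arg * I))⁻¹) by ring]
  have h2 : slitParam k s * (cexp ((slitParam k s).arg * I))⁻¹ = (‖slitParam k s‖ : ℂ) := by
    rw [mul_inv_eq_iff_eq_mul₀ hne, ha]
  rw [h2]; push_cast; ring


/-! ### Gaussian moments and tails on `(0, ∞)` -/

/-- `x ↦ x^n e^{-bx²}` is integrable on `(0, ∞)`. [folklore] -/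
theorem integrableOn_pow_mul_exp_neg_mul_sq (n : ℕ) {b : ℝ} (hb : 0 < b) :
    IntegrableOn (fun x : ℝ => x ^ n * Real.exp (-b * x ^ 2)) (Ioi 0) := by
  have h := (integrable_rpow_mul_exp_neg_mul_sq hb (s := n) (by have := n.cast_nonneg (α := ℝ); linarith)).integrableOn
    (s := Ioi 0)
  refine h.congr_fun (fun x _ => ?_) measurableSet_Ioi
  simp only [Real.rpow_natCast]

/-- **Gaussian moments**: `∫_0^∞ x^n e^{-bx²} dx = b^{-(n+1)/2} · ½ · Γ((n+1)/2)`. [folklore] -/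
theorem integral_pow_mul_exp_neg_mul_sq (n : ℕ) {b : ℝ} (hb : 0 < b) :
    ∫ x in Ioi (0 : ℝ), x ^ n * Real.exp (-b * x ^ 2) =
      b ^ (-((n : ℝ) + 1) / 2) * (1 / 2) * Real.Gamma (((n : ℝ) + 1) / 2) := by
  have h := _root_.integral_rpow_mul_exp_neg_mul_rpow (p := 2) (q := n) (b := b) (by norm_num)
    (by have := n.cast_nonneg (α := ℝ); linarith) hb
  rw [← h]
  refine setIntegral_congr_fun measurableSet_Ioi fun x _ => ?_
  simp only [Real.rpow_natCast, Real.rpow_two]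

/-- `Γ(3/2) = √π/2`. [folklore] -/
theorem Real_Gamma_three_halves : Real.Gamma (3 / 2) = Real.sqrt π / 2 := by
  rw [show (3 / 2 : ℝ) = 1 / 2 + 1 by norm_num, Real.Gamma_add_one (by norm_num), Real.Gamma_one_half_eq]; ring

/-- **Second moment**: `∫_0^∞ x² e^{-bx²} = √(π/b)/(4b)`. [folklore] -/
theorem integral_sq_mul_exp_neg_mul_sq {b : ℝ} (hb : 0 < b) :
    ∫ x in Ioi (0 : ℝ), x ^ 2 * Real.exp (-b * x ^ 2) = Real.sqrt (π / b) / (4 * b) := by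
  rw [integral_pow_mul_exp_neg_mul_sq 2 hb]
  have h32 : (((2 : ℕ) : ℝ) + 1) / 2 = 3 / 2 := by norm_num
  have h32' : -(((2 : ℕ) : ℝ) + 1) / 2 = -(1 / 2) - 1 := by norm_num
  rw [h32', h32, Real_Gamma_three_halves, Real.sqrt_div' _ hb.le, Real.rpow_sub hb, Real.rpow_neg hb.le,
    Real.rpow_one, ← Real.sqrt_eq_rpow b]
  ring

/-- **Moment bound**: `∫_0^∞ x^n e^{-bx²} ≤ Γ((n+1)/2) · b^{-(n+1)/2}` (we drop the `½`). [folklore] -/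
theorem integral_pow_mul_exp_neg_mul_sq_le (n : ℕ) {b : ℝ} (hb : 0 < b) :
    ∫ x in Ioi (0 : ℝ), x ^ n * Real.exp (-b * x ^ 2) ≤ Real.Gamma (((n : ℝ) + 1) / 2) * b ^ (-((n : ℝ) + 1) / 2) := by
  rw [integral_pow_mul_exp_neg_mul_sq n hb]
  have h1 : 0 < Real.Gamma (((n : ℝ) + 1) / 2) := Real.Gamma_pos_of_pos (by positivity)
  have h2 : 0 < b ^ (-((n : ℝ) + 1) / 2) := Real.rpow_pos_of_pos hb _
  nlinarith

/-- `∫_x^∞ w e^{-bw²} dw = e^{-bx²}/(2b)`. [folklore] -/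
theorem integral_mul_exp_neg_mul_sq_Ioi {b : ℝ} (hb : 0 < b) (x : ℝ) :
    ∫ w in Ioi x, w * Real.exp (-b * w ^ 2) = Real.exp (-b * x ^ 2) / (2 * b) := by
  have hderiv : ∀ w ∈ Ici x, HasDerivAt (fun w : ℝ => -Real.exp (-b * w ^ 2) / (2 * b)) (w * Real.exp (-b * w ^ 2)) w := by
    intro w _
    have e1 : HasDerivAt (fun w : ℝ => -b * w ^ 2) (-b * (2 * w)) w := by
      simpa using (hasDerivAt_pow 2 w).const_mul (-b)
    have e3 := (e1.exp.neg).div_const (2 * b)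
    refine e3.congr_deriv ?_
    rw [div_eq_iff (by positivity)]
    ring
  have hint : IntegrableOn (fun w : ℝ => w * Real.exp (-b * w ^ 2)) (Ioi x) :=
    (integrable_mul_exp_neg_mul_sq hb).integrableOn
  have htend : Tendsto (fun w : ℝ => -Real.exp (-b * w ^ 2) / (2 * b)) atTop (𝓝 (-0 / (2 * b))) := by
    refine (Tendsto.neg ?_).div_const _
    have : Tendsto (fun w : ℝ => -b * w ^ 2) atTop atBot :=
      (tendsto_pow_atTop (α := ℝ) two_ne_zero).const_mul_atTop_of_neg (neg_lt_zero.2 hb)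
    exact Real.tendsto_exp_atBot.comp this
  rw [integral_Ioi_of_hasDerivAt_of_tendsto' hderiv hint htend]
  ring

/-- **Gaussian tail**: `∫_x^∞ e^{-bw²} dw ≤ e^{-bx²}/(2bx)` for `x > 0`. [folklore] -/
theorem integral_exp_neg_mul_sq_Ioi_le {b x : ℝ} (hb : 0 < b) (hx : 0 < x) :
    ∫ w in Ioi x, Real.exp (-b * w ^ 2) ≤ Real.exp (-b * x ^ 2) / (2 * b * x) := by
  have hmono : ∫ w in Ioi x, Real.exp (-b * w ^ 2) ≤ ∫ w in Ioi x, x⁻¹ * (w * Real.exp (-b * w ^ 2)) := by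
    refine setIntegral_mono_on (integrable_exp_neg_mul_sq hb).integrableOn
      ((integrable_mul_exp_neg_mul_sq hb).integrableOn.const_mul _) measurableSet_Ioi fun w hw => ?_
    have hw' : x ≤ w := le_of_lt hw
    have he : 0 < Real.exp (-b * w ^ 2) := Real.exp_pos _
    have h1 : 1 ≤ x⁻¹ * w := by rw [inv_mul_eq_div]; exact (one_le_div hx).2 hw'
    calc Real.exp (-b * w ^ 2) = 1 * Real.exp (-b * w ^ 2) := (one_mul _).symm
      _ ≤ (x⁻¹ * w) * Real.exp (-b * w ^ 2) := by gcongr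
      _ = x⁻¹ * (w * Real.exp (-b * w ^ 2)) := by ring
  refine hmono.trans (le_of_eq ?_)
  rw [MeasureTheory.integral_const_mul, integral_mul_exp_neg_mul_sq_Ioi hb]
  field_simp

/-- `∫_x^∞ w³ e^{-bw²} dw = e^{-bx²}(bx² + 1)/(2b²)` for `x ≥ 0`. [folklore] -/
theorem integral_cube_mul_exp_neg_mul_sq_Ioi {b : ℝ} (hb : 0 < b) {x : ℝ} (hx : 0 ≤ x) :
    ∫ w in Ioi x, w ^ 3 * Real.exp (-b * w ^ 2) = Real.exp (-b * x ^ 2) * (b * x ^ 2 + 1) / (2 * b ^ 2) := by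
  have hderiv : ∀ w ∈ Ici x, HasDerivAt (fun w : ℝ => -Real.exp (-b * w ^ 2) * (b * w ^ 2 + 1) / (2 * b ^ 2))
      (w ^ 3 * Real.exp (-b * w ^ 2)) w := by
    intro w _
    have e1 : HasDerivAt (fun w : ℝ => -b * w ^ 2) (-b * (2 * w)) w := by
      simpa using (hasDerivAt_pow 2 w).const_mul (-b)
    have hp : HasDerivAt (fun w : ℝ => b * w ^ 2 + 1) (b * (2 * w)) w := by
      simpa using ((hasDerivAt_pow 2 w).const_mul b).add_const 1
    have e3 := ((e1.exp.neg).mul hp).div_const (2 * b ^ 2)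
    refine e3.congr_deriv ?_
    rw [div_eq_iff (by positivity)]
    simp only [Pi.neg_apply]
    ring
  have hint : IntegrableOn (fun w : ℝ => w ^ 3 * Real.exp (-b * w ^ 2)) (Ioi x) :=
    (integrableOn_pow_mul_exp_neg_mul_sq 3 hb).mono_set (Ioi_subset_Ioi hx)
  have h1 : Tendsto (fun w : ℝ => b * w ^ 2) atTop atTop :=
    (tendsto_pow_atTop (α := ℝ) two_ne_zero).const_mul_atTop hb
  have h2 : Tendsto (fun u : ℝ => Real.exp (-u) * (u + 1)) atTop (𝓝 0) := by
    have ha := Real.tendsto_pow_mul_exp_neg_atTop_nhds_zero 1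
    have hb' := Real.tendsto_pow_mul_exp_neg_atTop_nhds_zero 0
    have := ha.add hb'
    simp only [pow_one, pow_zero, one_mul, add_zero] at this
    refine this.congr' (Eventually.of_forall fun u => ?_)
    ring
  have h3 : Tendsto (fun w : ℝ => Real.exp (-(b * w ^ 2)) * (b * w ^ 2 + 1)) atTop (𝓝 0) := h2.comp h1
  have h4 := (h3.neg).div_const (2 * b ^ 2)
  have htend : Tendsto (fun w : ℝ => -Real.exp (-b * w ^ 2) * (b * w ^ 2 + 1) / (2 * b ^ 2)) atTop (𝓝 (-0 / (2 * b ^ 2))) := by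
    refine h4.congr fun w => ?_
    rw [neg_mul b]; ring
  rw [integral_Ioi_of_hasDerivAt_of_tendsto' hderiv hint htend]
  ring

/-- **Second-moment tail**: `∫_x^∞ w² e^{-bw²} dw ≤ e^{-bx²}(bx² + 1)/(2b²x)` for `x > 0`. [folklore] -/
theorem integral_sq_mul_exp_neg_mul_sq_Ioi_le {b x : ℝ} (hb : 0 < b) (hx : 0 < x) :
    ∫ w in Ioi x, w ^ 2 * Real.exp (-b * w ^ 2) ≤ Real.exp (-b * x ^ 2) * (b * x ^ 2 + 1) / (2 * b ^ 2 * x) := by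
  have hint3 : IntegrableOn (fun w : ℝ => w ^ 3 * Real.exp (-b * w ^ 2)) (Ioi x) :=
    (integrableOn_pow_mul_exp_neg_mul_sq 3 hb).mono_set (Ioi_subset_Ioi hx.le)
  have hint2 : IntegrableOn (fun w : ℝ => w ^ 2 * Real.exp (-b * w ^ 2)) (Ioi x) :=
    (integrableOn_pow_mul_exp_neg_mul_sq 2 hb).mono_set (Ioi_subset_Ioi hx.le)
  have hmono : ∫ w in Ioi x, w ^ 2 * Real.exp (-b * w ^ 2) ≤ ∫ w in Ioi x, x⁻¹ * (w ^ 3 * Real.exp (-b * w ^ 2)) := by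
    refine setIntegral_mono_on hint2 (hint3.const_mul _) measurableSet_Ioi fun w hw => ?_
    have hw' : x ≤ w := le_of_lt hw
    have h1 : 1 ≤ x⁻¹ * w := by rw [inv_mul_eq_div]; exact (one_le_div hx).2 hw'
    have h0 : 0 ≤ w ^ 2 * Real.exp (-b * w ^ 2) := by positivity
    calc w ^ 2 * Real.exp (-b * w ^ 2) = 1 * (w ^ 2 * Real.exp (-b * w ^ 2)) := (one_mul _).symm
      _ ≤ (x⁻¹ * w) * (w ^ 2 * Real.exp (-b * w ^ 2)) := by gcongr
      _ = x⁻¹ * (w ^ 3 * Real.exp (-b * w ^ 2)) := by ring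
  refine hmono.trans (le_of_eq ?_)
  rw [MeasureTheory.integral_const_mul, integral_cube_mul_exp_neg_mul_sq_Ioi hb hx.le]
  field_simp

/-- **Exponential beats polynomial**: `x^j e^{-√x/8} ≤ 64^j (2j)!` for `x ≥ 0`. [folklore] -/
theorem pow_mul_exp_neg_sqrt_le (j : ℕ) {x : ℝ} (hx : 0 ≤ x) :
    x ^ j * Real.exp (-(Real.sqrt x / 8)) ≤ 64 ^ j * (2 * j).factorial := by
  set y := Real.sqrt x / 8 with hy
  have hy0 : 0 ≤ y := by positivity
  have hxy : x = 64 * y ^ 2 := by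
    rw [hy, div_pow, Real.sq_sqrt hx]; ring
  have h := Real.pow_div_factorial_le_exp (x := y) (hx := hy0) (n := 2 * j)
  have hf : (0 : ℝ) < (2 * j).factorial := by exact_mod_cast Nat.factorial_pos _
  rw [div_le_iff₀ hf] at h
  have he : 0 < Real.exp y := Real.exp_pos _
  rw [hxy, mul_pow, ← pow_mul, Real.exp_neg]
  rw [show (64 : ℝ) ^ j * y ^ (2 * j) * (Real.exp y)⁻¹ = 64 ^ j * (y ^ (2 * j) / Real.exp y) by ring]
  gcongr
  rw [div_le_iff₀ he]
  linarith

/-! ### A general amplitude: `E^k Y^s Φ` and its contour identity -/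

/-- The integrand with a general amplitude `Φ`: `E(z)^k Y(z)^s Φ(z)`. [folklore] -/
def slitJg (Φ : ℂ → ℂ) (k : ℤ) (s : ℕ) (z : ℂ) : ℂ := slitEc z ^ k * slitYc z ^ s * Φ z

/-- `slitJc = slitJg slitAc`. [folklore] -/
theorem slitJc_eq_slitJg (k : ℤ) (s : ℕ) : slitJc k s = slitJg slitAc k s := rfl

/-- Off the singular set `E^k Y^s Φ` is differentiable when `Φ` is. [folklore] -/
theorem differentiableAt_slitJg {Φ : ℂ → ℂ} (k : ℤ) (s : ℕ) {z : ℂ} (hz : z ∉ slitPoles) (hΦ : DifferentiableAt ℂ Φ z) :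
    DifferentiableAt ℂ (slitJg Φ k s) z := by
  have h := differentiableAt_slitJc k s hz
  simp only [slitPoles, mem_setOf_eq, not_or] at hz
  have hA : slitAc z ≠ 0 := inv_ne_zero hz.1
  have hAd : DifferentiableAt ℂ slitAc z := by
    unfold slitAc
    exact ((differentiableAt_const _).add ((differentiableAt_const _).mul (differentiableAt_id.pow 2))).inv hz.1
  have hEY : DifferentiableAt ℂ (fun z => slitEc z ^ k * slitYc z ^ s) z := by
    have h2 := h.mul (hAd.inv hA)
    refine h2.congr_of_eventuallyEq ?_
    have hne : ∀ᶠ w in 𝓝 z, slitAc w ≠ 0 := hAd.continuousAt.eventually_ne hA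
    filter_upwards [hne] with w hw
    change slitEc w ^ k * slitYc w ^ s = slitEc w ^ k * slitYc w ^ s * slitAc w * (slitAc w)⁻¹
    rw [mul_inv_cancel_right₀ hw]
  exact hEY.mul hΦ

/-- **Rotating the contour, general amplitude.** For `|θ| < π/4` and `Φ` holomorphic off the
singular set, `∫_0^1 E^kY^sΦ = e^{iθ}∫_0^1 (E^kY^sΦ)(we^{iθ}) dw + ∫_θ^0 (E^kY^sΦ)(e^{iφ}) ie^{iφ} dφ`. [folklore] -/
theorem integral_slitJg_eq_ray_add_arc {Φ : ℂ → ℂ} (hΦ : ∀ z, z ∉ slitPoles → DifferentiableAt ℂ Φ z) (k : ℤ) (s : ℕ)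
    {θ : ℝ} (hθ : |θ| < π / 4) :
    ∫ t in (0 : ℝ)..1, slitJg Φ k s (t : ℂ) =
      cexp ((θ : ℂ) * I) * (∫ w in (0 : ℝ)..1, slitJg Φ k s ((w : ℂ) * cexp ((θ : ℂ) * I))) +
      ∫ φ in θ..0, slitJg Φ k s (cexp ((φ : ℂ) * I)) * (cexp ((φ : ℂ) * I) * I) := by
  set c := sectorCentre θ with hc
  set R := Real.sqrt (sectorRadSq θ) with hR
  have hdiff : DifferentiableOn ℂ (slitJg Φ k s) (ball c R) := fun z hz =>
    (differentiableAt_slitJg k s (not_mem_slitPoles_of_mem_ball hθ hz)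
      (hΦ z (not_mem_slitPoles_of_mem_ball hθ hz))).differentiableWithinAt
  obtain ⟨g, hg⟩ := hdiff.isExactOn_ball
  have hcont : ContinuousOn (slitJg Φ k s) (ball c R) := hdiff.continuousOn
  have hθmem : θ ∈ uIcc θ 0 := left_mem_uIcc
  have h0mem : (0 : ℝ) ∈ uIcc θ 0 := right_mem_uIcc
  have hseg_mem : ∀ t ∈ uIcc (0 : ℝ) 1, (t : ℂ) ∈ ball c R := by
    intro t ht
    rw [uIcc_of_le zero_le_one] at ht
    have h := mem_ball_sectorCentre hθ ht.1 ht.2 h0mem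
    simpa using h
  have hseg : ∫ t in (0 : ℝ)..1, slitJg Φ k s (t : ℂ) = g 1 - g 0 := by
    have hd : ∀ t ∈ uIcc (0 : ℝ) 1, HasDerivAt (fun x : ℝ => g (x : ℂ)) (slitJg Φ k s (t : ℂ)) t := by
      intro t ht
      have h := (hg _ (hseg_mem t ht)).comp t ((hasDerivAt_id t).ofReal_comp)
      rw [ofReal_one, mul_one] at h
      exact h
    have h := intervalIntegral.integral_eq_sub_of_hasDerivAt hd ?_
    · simpa using h
    · refine ContinuousOn.intervalIntegrable ?_
      exact hcont.comp (Continuous.continuousOn (by fun_prop)) fun t ht => hseg_mem t ht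
  have hray_mem : ∀ w ∈ uIcc (0 : ℝ) 1, (w : ℂ) * cexp ((θ : ℂ) * I) ∈ ball c R := by
    intro w hw
    rw [uIcc_of_le zero_le_one] at hw
    exact mem_ball_sectorCentre hθ hw.1 hw.2 hθmem
  have hray : ∫ w in (0 : ℝ)..1, slitJg Φ k s ((w : ℂ) * cexp ((θ : ℂ) * I)) * cexp ((θ : ℂ) * I) =
      g (cexp ((θ : ℂ) * I)) - g 0 := by
    have hd : ∀ w ∈ uIcc (0 : ℝ) 1, HasDerivAt (fun x : ℝ => g ((x : ℂ) * cexp ((θ : ℂ) * I)))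
        (slitJg Φ k s ((w : ℂ) * cexp ((θ : ℂ) * I)) * cexp ((θ : ℂ) * I)) w := by
      intro w hw
      have h := (hg _ (hray_mem w hw)).comp w (((hasDerivAt_id w).ofReal_comp).mul_const (cexp ((θ : ℂ) * I)))
      rw [ofReal_one, one_mul] at h
      exact h
    have h := intervalIntegral.integral_eq_sub_of_hasDerivAt hd ?_
    · simpa using h
    · refine ContinuousOn.intervalIntegrable ?_
      refine ContinuousOn.mul ?_ continuousOn_const
      exact hcont.comp (Continuous.continuousOn (by fun_prop)) fun w hw => hray_mem w hw
  have harc_mem : ∀ φ ∈ uIcc θ 0, cexp ((φ : ℂ) * I) ∈ ball c R := by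
    intro φ hφ
    have h := mem_ball_sectorCentre hθ zero_le_one le_rfl hφ
    simpa using h
  have harc : ∫ φ in θ..0, slitJg Φ k s (cexp ((φ : ℂ) * I)) * (cexp ((φ : ℂ) * I) * I) = g 1 - g (cexp ((θ : ℂ) * I)) := by
    have hd : ∀ φ ∈ uIcc θ 0, HasDerivAt (fun x : ℝ => g (cexp ((x : ℂ) * I)))
        (slitJg Φ k s (cexp ((φ : ℂ) * I)) * (cexp ((φ : ℂ) * I) * I)) φ := fun φ hφ =>
      (hg _ (harc_mem φ hφ)).comp φ (hasDerivAt_cexp_mul_I φ)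
    have h := intervalIntegral.integral_eq_sub_of_hasDerivAt hd ?_
    · simpa using h
    · refine ContinuousOn.intervalIntegrable ?_
      refine ContinuousOn.mul ?_ (Continuous.continuousOn (by fun_prop))
      exact hcont.comp (Continuous.continuousOn (by fun_prop)) fun φ hφ => harc_mem φ hφ
  rw [hseg]
  rw [intervalIntegral.integral_mul_const] at hray
  linear_combination (-1 : ℂ) * hray - harc

/-! ### Moduli on the unit arc `v = e^{iφ}` -/

/-- `e^{iφ} = 1 · e^{iφ}` as a ray point with `w = 1`. [folklore] -/
theorem cexp_eq_one_ray (φ : ℝ) : cexp ((φ : ℂ) * I) = ((1 : ℝ) : ℂ) * cexp ((φ : ℂ) * I) := by simp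

/-- **`‖Y(e^{iφ})‖ ≤ |tan φ|`** (in fact equality) for `cos φ ≠ 0`. [folklore] -/
theorem norm_slitYc_arc_le {φ : ℝ} (hc : 0 < Real.cos φ) : ‖slitYc (cexp ((φ : ℂ) * I))‖ ≤ |Real.tan φ| := by
  have h1 : ‖(1 : ℂ) - (cexp ((φ : ℂ) * I)) ^ 2‖ ^ 2 = 4 * Real.sin φ ^ 2 := by
    rw [cexp_eq_one_ray, normSq_one_sub_ray, Real.cos_two_mul, Real.cos_sq']; ring
  have h2 : ‖(1 : ℂ) + (cexp ((φ : ℂ) * I)) ^ 2‖ ^ 2 = 4 * Real.cos φ ^ 2 := by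
    rw [cexp_eq_one_ray, normSq_one_add_ray, Real.cos_two_mul]; ring
  have hn1 : ‖(1 : ℂ) - (cexp ((φ : ℂ) * I)) ^ 2‖ = 2 * |Real.sin φ| := by
    have h0 : 0 ≤ ‖(1 : ℂ) - (cexp ((φ : ℂ) * I)) ^ 2‖ := norm_nonneg _
    nlinarith [abs_nonneg (Real.sin φ), sq_abs (Real.sin φ), sq_nonneg (‖(1 : ℂ) - (cexp ((φ : ℂ) * I)) ^ 2‖ - 2 * |Real.sin φ|),
      sq_nonneg (‖(1 : ℂ) - (cexp ((φ : ℂ) * I)) ^ 2‖ + 2 * |Real.sin φ|)]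
  have hn2 : ‖(1 : ℂ) + (cexp ((φ : ℂ) * I)) ^ 2‖ = 2 * Real.cos φ := by
    have h0 : 0 ≤ ‖(1 : ℂ) + (cexp ((φ : ℂ) * I)) ^ 2‖ := norm_nonneg _
    nlinarith [sq_nonneg (‖(1 : ℂ) + (cexp ((φ : ℂ) * I)) ^ 2‖ - 2 * Real.cos φ),
      sq_nonneg (‖(1 : ℂ) + (cexp ((φ : ℂ) * I)) ^ 2‖ + 2 * Real.cos φ)]
  rw [slitYc, norm_div, hn1, hn2, Real.tan_eq_sin_div_cos, abs_div, abs_of_pos hc]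
  apply le_of_eq; field_simp

/-- **`‖E(e^{iφ})^k‖ ≤ exp(-|k| |sin 2φ|/2)`** when `k sin 2φ ≤ 0`. [folklore] -/
theorem norm_slitEc_zpow_arc_le (k : ℤ) {φ : ℝ} (hk : (k : ℝ) * Real.sin (2 * φ) ≤ 0) :
    ‖slitEc (cexp ((φ : ℂ) * I)) ^ k‖ ≤ Real.exp (-(|(k : ℝ)| * |Real.sin (2 * φ)| / 2)) := by
  have h := norm_slitEc_zpow_ray_le k (w := 1) hk
  rw [← cexp_eq_one_ray] at h
  refine h.trans (le_of_eq ?_)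
  congr 1; ring

/-- `|tan φ| ≤ 2|φ|` and `|tan φ| ≤ 1` for `|φ| ≤ π/4`; `|tan φ| ≤ 1/2` for `|φ| ≤ π/8`. [folklore] -/
theorem abs_tan_le_two_mul_abs {φ : ℝ} (hφ : |φ| ≤ π / 4) : |Real.tan φ| ≤ 2 * |φ| := by
  have hπ := Real.pi_pos
  have hc : Real.cos (π / 4) ≤ Real.cos φ := by
    rw [← Real.cos_abs φ]
    exact Real.cos_le_cos_of_nonneg_of_le_pi (abs_nonneg _) (by linarith) hφ
  rw [Real.cos_pi_div_four] at hc
  have hs2 : (1 : ℝ) / 2 ≤ Real.sqrt 2 / 2 := by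
    have : (1 : ℝ) ≤ Real.sqrt 2 := Real.one_le_sqrt.2 (by norm_num)
    linarith
  have hcpos : 0 < Real.cos φ := by linarith
  rw [Real.tan_eq_sin_div_cos, abs_div, abs_of_pos hcpos, div_le_iff₀ hcpos]
  have := Real.abs_sin_le_abs (x := φ)
  nlinarith [abs_nonneg φ]

/-- `|tan φ| ≤ 1` for `|φ| ≤ π/4`. [folklore] -/
theorem abs_tan_le_one {φ : ℝ} (hφ : |φ| ≤ π / 4) : |Real.tan φ| ≤ 1 := by
  have hπ := Real.pi_pos
  rw [← Real.tan_pi_div_four, abs_le]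
  have h1 : Real.tan φ ≤ Real.tan (π / 4) := by
    rcases eq_or_lt_of_le (abs_le.1 hφ).2 with h | h
    · rw [h]
    · exact (Real.tan_lt_tan_of_lt_of_lt_pi_div_two (by linarith [(abs_le.1 hφ).1]) (by linarith) h).le
  have h2 : Real.tan (-(π / 4)) ≤ Real.tan φ := by
    rcases eq_or_lt_of_le (abs_le.1 hφ).1 with h | h
    · rw [← h]
    · exact (Real.tan_lt_tan_of_lt_of_lt_pi_div_two (by linarith) (by linarith [(abs_le.1 hφ).2]) h).le
  rw [Real.tan_neg] at h2
  exact ⟨h2, h1⟩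

/-- `|tan φ| ≤ 1/2` for `|φ| ≤ π/8`. [folklore] -/
theorem abs_tan_le_half {φ : ℝ} (hφ : |φ| ≤ π / 8) : |Real.tan φ| ≤ 1 / 2 := by
  have hπ := Real.pi_lt_d2
  have hπ0 := Real.pi_pos
  have hc : Real.cos (π / 6) ≤ Real.cos φ := by
    rw [← Real.cos_abs φ]
    exact Real.cos_le_cos_of_nonneg_of_le_pi (abs_nonneg _) (by linarith) (by linarith)
  rw [Real.cos_pi_div_six] at hc
  have hs3 : (1.7 : ℝ) ≤ Real.sqrt 3 := by
    rw [Real.le_sqrt (by norm_num) (by norm_num)]; norm_num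
  have hcpos : 0 < Real.cos φ := by linarith
  rw [Real.tan_eq_sin_div_cos, abs_div, abs_of_pos hcpos, div_le_iff₀ hcpos]
  have := Real.abs_sin_le_abs (x := φ)
  nlinarith [abs_nonneg φ]

/-- Jordan: `|φ| ≤ |sin 2φ|` for `|φ| ≤ π/4` (from `(2/π)x ≤ sin x`). [folklore] -/
theorem abs_le_abs_sin_two_mul {φ : ℝ} (hφ : |φ| ≤ π / 4) : |φ| ≤ |Real.sin (2 * φ)| := by
  have hπ := Real.pi_pos
  have hπ3 := Real.pi_lt_d2
  have h := Real.mul_le_sin (x := 2 * |φ|) (by positivity) (by linarith)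
  have hs : Real.sin (2 * |φ|) = |Real.sin (2 * φ)| := by
    rw [show 2 * |φ| = |2 * φ| by rw [abs_mul, abs_two], ← abs_sin_eq_sin_abs (by rw [abs_mul, abs_two]; linarith)]
  rw [hs] at h
  have : |φ| ≤ 2 / π * (2 * |φ|) := by
    rw [show 2 / π * (2 * |φ|) = (4 / π) * |φ| by ring]
    have h4 : 1 ≤ 4 / π := by rw [le_div_iff₀ hπ]; linarith
    nlinarith [abs_nonneg φ]
  linarith

/-- `sin(π/4) ≤ |sin 2φ|` for `π/8 ≤ |φ| ≤ π/4`. [folklore] -/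
theorem sin_pi_div_four_le_abs_sin {φ : ℝ} (h1 : π / 8 ≤ |φ|) (h2 : |φ| ≤ π / 4) :
    Real.sqrt 2 / 2 ≤ |Real.sin (2 * φ)| := by
  have hπ := Real.pi_pos
  have h2φ : |2 * φ| ≤ π := by rw [abs_mul, abs_two]; linarith
  have hs : |Real.sin (2 * φ)| = Real.sin (2 * |φ|) := by
    rw [abs_sin_eq_sin_abs h2φ, abs_mul, abs_two]
  rw [← Real.sin_pi_div_four, hs]
  exact Real.sin_le_sin_of_le_of_le_pi_div_two (by linarith) (by linarith) (by linarith)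

/-- `∫_0^T φ e^{-cφ} dφ ≤ 1/c²` for `c > 0`, `T ≥ 0`. [folklore] -/
theorem integral_mul_exp_neg_le {c T : ℝ} (hc : 0 < c) (hT : 0 ≤ T) :
    ∫ φ in (0 : ℝ)..T, φ * Real.exp (-c * φ) ≤ 1 / c ^ 2 := by
  have hderiv : ∀ φ ∈ uIcc (0 : ℝ) T, HasDerivAt (fun φ : ℝ => -(c * φ + 1) * Real.exp (-c * φ) / c ^ 2)
      (φ * Real.exp (-c * φ)) φ := by
    intro φ _
    have e1 : HasDerivAt (fun φ : ℝ => -c * φ) (-c) φ := by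
      have h := (hasDerivAt_id φ).const_mul (-c)
      rw [mul_one] at h
      exact h
    have e2 : HasDerivAt (fun φ : ℝ => -(c * φ + 1)) (-c) φ := by
      have h := (((hasDerivAt_id φ).const_mul c).add_const 1).neg
      rw [mul_one] at h
      exact h
    have e3 := (e2.mul e1.exp).div_const (c ^ 2)
    refine e3.congr_deriv ?_
    rw [div_eq_iff (by positivity)]
    ring
  rw [intervalIntegral.integral_eq_sub_of_hasDerivAt hderiv ((by fun_prop : Continuous fun φ : ℝ => φ * Real.exp (-c * φ)).intervalIntegrable _ _)]
  have h1 : 0 ≤ (c * T + 1) * Real.exp (-c * T) := by positivity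
  have heq : -(c * T + 1) * Real.exp (-c * T) / c ^ 2 - -(c * 0 + 1) * Real.exp (-c * 0) / c ^ 2 =
      (1 - (c * T + 1) * Real.exp (-c * T)) / c ^ 2 := by
    rw [mul_zero, mul_zero, Real.exp_zero]; ring
  show -(c * T + 1) * Real.exp (-c * T) / c ^ 2 - -(c * 0 + 1) * Real.exp (-c * 0) / c ^ 2 ≤ 1 / c ^ 2
  rw [heq]
  exact div_le_div_of_nonneg_right (by linarith) (by positivity)

/-- **Exponential beats polynomial, linear rate**: `x^n e^{-x/m} ≤ m^n n!` for `x ≥ 0`, `m > 0`. [folklore] -/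
theorem pow_mul_exp_neg_div_le (n : ℕ) {m x : ℝ} (hm : 0 < m) (hx : 0 ≤ x) :
    x ^ n * Real.exp (-(x / m)) ≤ m ^ n * n.factorial := by
  have hy0 : 0 ≤ x / m := by positivity
  have h := Real.pow_div_factorial_le_exp (x := x / m) (hx := hy0) (n := n)
  have hf : (0 : ℝ) < n.factorial := by exact_mod_cast Nat.factorial_pos _
  rw [div_le_iff₀ hf, div_pow, div_le_iff₀ (by positivity)] at h
  rw [Real.exp_neg, ← div_eq_mul_inv, div_le_iff₀ (Real.exp_pos _)]
  nlinarith [Real.exp_pos (x / m)]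

/-- `n² ≤ 2 · 2^n`. [folklore] -/
theorem sq_le_two_mul_two_pow (n : ℕ) : n ^ 2 ≤ 2 * 2 ^ n := by
  induction n with
  | zero => norm_num
  | succ m ih =>
    have h := Nat.lt_two_pow_self (n := m)
    rcases Nat.lt_or_ge m 2 with hm | hm
    · interval_cases m <;> norm_num
    · have h1 : (m + 1) ^ 2 = m ^ 2 + 2 * m + 1 := by ring
      have h2 : 2 * 2 ^ (m + 1) = 2 * (2 * 2 ^ m) := by ring
      rw [h1, h2]
      nlinarith [ih, h]

/-- `(1/2)^s ≤ 2/s²` for `s ≥ 1`. [folklore] -/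
theorem half_pow_le {s : ℕ} (hs : 1 ≤ s) : (1 / 2 : ℝ) ^ s ≤ 2 / (s : ℝ) ^ 2 := by
  have h := sq_le_two_mul_two_pow s
  have h' : ((s : ℝ)) ^ 2 ≤ 2 * 2 ^ s := by exact_mod_cast h
  have hs' : (0 : ℝ) < (s : ℝ) ^ 2 := by positivity
  rw [one_div, inv_pow, inv_eq_one_div, div_le_div_iff₀ (by positivity) hs', one_mul]
  exact h'

/-! ### The arc integral is `O(M/‖a‖²)` -/

/-- For an even nonnegative `g`: `|∫_θ^0 g| = ∫_0^{|θ|} g`. [folklore] -/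
theorem abs_integral_to_zero_of_even {g : ℝ → ℝ} (heven : ∀ x, g (-x) = g x) (hnn : ∀ x, 0 ≤ g x) (θ : ℝ) :
    |∫ x in θ..0, g x| = ∫ x in (0 : ℝ)..|θ|, g x := by
  rcases le_total θ 0 with h | h
  · rw [abs_of_nonpos h]
    have h1 : ∫ x in θ..0, g x = ∫ x in (0 : ℝ)..(-θ), g x := by
      have h2 := intervalIntegral.integral_comp_neg (a := 0) (b := -θ) (f := g)
      simp only [neg_neg, neg_zero] at h2
      rw [← h2]
      exact intervalIntegral.integral_congr fun x _ => heven x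
    rw [h1, abs_of_nonneg (intervalIntegral.integral_nonneg (by linarith) fun x _ => hnn x)]
  · rw [abs_of_nonneg h, intervalIntegral.integral_symm, abs_neg,
      abs_of_nonneg (intervalIntegral.integral_nonneg h fun x _ => hnn x)]

/-- On the arc: `|φ| ≤ |θ_a|` and `k sin 2φ ≤ 0` for `φ` between `θ_a` and `0`. [folklore] -/
theorem arc_angle_props (k : ℤ) {s : ℕ} (hs : 1 ≤ s) {φ : ℝ} (hφ : φ ∈ uIcc (rotAngle k s) 0) :
    |φ| ≤ |rotAngle k s| ∧ (k : ℝ) * Real.sin (2 * φ) ≤ 0 := by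
  have hπ := Real.pi_pos
  have hθ := abs_rotAngle_lt k hs
  have hsin := sin_two_mul_rotAngle k s
  have ha : 0 < ‖slitParam k s‖ := by linarith [one_le_norm_slitParam k hs]
  set θ := rotAngle k s with hθdef
  have habsφ : |φ| ≤ |θ| := by
    rcases le_total θ 0 with h | h
    · rw [uIcc_of_le h] at hφ; rw [abs_of_nonpos h, abs_of_nonpos hφ.2]; linarith [hφ.1]
    · rw [uIcc_of_ge h] at hφ; rw [abs_of_nonneg h, abs_of_nonneg hφ.1]; linarith [hφ.2]
  refine ⟨habsφ, ?_⟩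
  rcases lt_trichotomy k 0 with hk | rfl | hk
  · -- `k < 0`: `sin 2θ > 0`, so `θ > 0`, `φ ≥ 0`, `sin 2φ ≥ 0`
    have hk' : (k : ℝ) < 0 := by exact_mod_cast hk
    have hs2 : 0 < Real.sin (2 * θ) := by rw [hsin]; exact div_pos (by linarith) ha
    have hθpos : 0 < θ := by
      by_contra hcon
      have hcon : θ ≤ 0 := le_of_not_gt hcon
      have : Real.sin (2 * θ) ≤ 0 :=
        Real.sin_nonpos_of_nonpos_of_neg_pi_le (by linarith) (by linarith [abs_lt.1 hθ])
      linarith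
    rw [uIcc_of_ge hθpos.le] at hφ
    have hsφ : 0 ≤ Real.sin (2 * φ) := Real.sin_nonneg_of_nonneg_of_le_pi (by linarith [hφ.1])
      (by linarith [hφ.2, abs_lt.1 hθ, le_abs_self θ])
    nlinarith
  · simp
  · have hk' : (0 : ℝ) < k := by exact_mod_cast hk
    have hs2 : Real.sin (2 * θ) < 0 := by rw [hsin]; exact div_neg_of_neg_of_pos (by linarith) ha
    have hθneg : θ < 0 := by
      by_contra hcon
      have hcon : 0 ≤ θ := le_of_not_gt hcon
      have : 0 ≤ Real.sin (2 * θ) :=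
        Real.sin_nonneg_of_nonneg_of_le_pi (by linarith) (by linarith [abs_lt.1 hθ])
      linarith
    rw [uIcc_of_le hθneg.le] at hφ
    have hsφ : Real.sin (2 * φ) ≤ 0 := Real.sin_nonpos_of_nonpos_of_neg_pi_le (by linarith [hφ.2])
      (by linarith [hφ.1, abs_lt.1 hθ, neg_abs_le θ])
    nlinarith

/-- `|k| < s` forces `|θ_a| < π/8`. [folklore] -/
theorem abs_rotAngle_lt_of_lt (k : ℤ) {s : ℕ} (hs : 1 ≤ s) (hks : |k| < s) : |rotAngle k s| < π / 8 := by
  have hπ := Real.pi_pos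
  have hθ := abs_rotAngle_lt k hs
  have ha : 0 < ‖slitParam k s‖ := by linarith [one_le_norm_slitParam k hs]
  set θ := rotAngle k s with hθdef
  have hsin : |Real.sin (2 * θ)| = |(k : ℝ)| / ‖slitParam k s‖ := by
    rw [sin_two_mul_rotAngle, abs_div, abs_neg, abs_of_pos ha]
  -- `|k|/‖a‖ < √2/2`
  have hk2 : |(k : ℝ)| / ‖slitParam k s‖ < Real.sqrt 2 / 2 := by
    rw [div_lt_div_iff₀ ha (by norm_num : (0 : ℝ) < 2)]
    have hks' : |(k : ℝ)| < s := by exact_mod_cast hks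
    have hsq := norm_slitParam_sq k s
    have h2 : |(k : ℝ)| ^ 2 = (k : ℝ) ^ 2 := sq_abs _
    -- `2|k| < √2 ‖a‖` iff `4k² < 2‖a‖²`
    have h4 : 4 * (k : ℝ) ^ 2 < 2 * ‖slitParam k s‖ ^ 2 := by nlinarith [abs_nonneg (k : ℝ)]
    have h5 : (|(k : ℝ)| * 2) ^ 2 < (Real.sqrt 2 * ‖slitParam k s‖) ^ 2 := by
      rw [mul_pow, mul_pow, Real.sq_sqrt (by norm_num)]; nlinarith
    exact lt_of_pow_lt_pow_left₀ 2 (by positivity) h5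
  rw [← hsin, ← Real.sin_pi_div_four] at hk2
  -- `sin |2θ| < sin (π/4)` with both in `[0, π/2]` gives `|2θ| < π/4`
  have h2θ : |2 * θ| ≤ π := by rw [abs_mul, abs_two]; linarith
  rw [abs_sin_eq_sin_abs h2θ] at hk2
  have hlt : |2 * θ| < π / 4 := by
    by_contra hcon
    have hcon : π / 4 ≤ |2 * θ| := le_of_not_gt hcon
    have := Real.sin_le_sin_of_le_of_le_pi_div_two (by linarith) (by rw [abs_mul, abs_two]; linarith) hcon
    linarith
  rw [abs_mul, abs_two] at hlt
  linarith

/-- `|k| ≥ s` gives `‖a‖² ≤ (9/4) k²`. [folklore] -/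
theorem norm_sq_le_of_le (k : ℤ) (s : ℕ) (hks : (s : ℤ) ≤ |k|) : ‖slitParam k s‖ ^ 2 ≤ 9 / 4 * (k : ℝ) ^ 2 := by
  have hks' : (s : ℝ) ≤ |(k : ℝ)| := by
    have : ((s : ℤ) : ℝ) ≤ ((|k| : ℤ) : ℝ) := by exact_mod_cast hks
    simpa using this
  rw [norm_slitParam_sq]
  have h2 : |(k : ℝ)| ^ 2 = (k : ℝ) ^ 2 := sq_abs _
  nlinarith [abs_nonneg (k : ℝ), Nat.cast_nonneg (α := ℝ) s]

/-- **The arc bound.** For an amplitude bounded by `M` near the real axis (`|φ| ≤ π/8`) and by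
`M‖a‖` on the whole arc, the arc integral is at most `1400 M/‖a‖²`. [folklore] -/
theorem norm_arc_integral_le {Φ : ℂ → ℂ} {M : ℝ} (hM : 0 ≤ M) (k : ℤ) {s : ℕ} (hs : 1 ≤ s)
    (h1 : ∀ φ ∈ uIcc (rotAngle k s) 0, |φ| ≤ π / 8 → ‖Φ (cexp ((φ : ℂ) * I))‖ ≤ M)
    (h2 : ∀ φ ∈ uIcc (rotAngle k s) 0, ‖Φ (cexp ((φ : ℂ) * I))‖ ≤ M * ‖slitParam k s‖) :
    ‖∫ φ in (rotAngle k s)..0, slitJg Φ k s (cexp ((φ : ℂ) * I)) * (cexp ((φ : ℂ) * I) * I)‖ ≤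
      1400 * M / ‖slitParam k s‖ ^ 2 := by
  have hπ := Real.pi_pos
  have hπ3 := Real.pi_lt_d2
  set θ := rotAngle k s with hθdef
  set a := ‖slitParam k s‖ with hadef
  have ha1 : 1 ≤ a := one_le_norm_slitParam k hs
  have ha0 : 0 < a := by linarith
  have hθ : |θ| < π / 4 := abs_rotAngle_lt k hs
  have hθ1 : |θ| ≤ 1 := by linarith
  -- the norm of the integrand
  have hF : ∀ φ : ℝ, ‖slitJg Φ k s (cexp ((φ : ℂ) * I)) * (cexp ((φ : ℂ) * I) * I)‖ =
      ‖slitEc (cexp ((φ : ℂ) * I)) ^ k‖ * ‖slitYc (cexp ((φ : ℂ) * I))‖ ^ s * ‖Φ (cexp ((φ : ℂ) * I))‖ := by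
    intro φ
    rw [norm_mul, norm_mul, Complex.norm_I, mul_one, Complex.norm_exp_ofReal_mul_I, mul_one, slitJg, norm_mul, norm_mul,
      norm_pow]
  -- common pointwise facts on the arc
  have hpt : ∀ φ ∈ uIcc θ 0, ‖slitEc (cexp ((φ : ℂ) * I)) ^ k‖ ≤ Real.exp (-(|(k : ℝ)| * |Real.sin (2 * φ)| / 2)) ∧
      ‖slitYc (cexp ((φ : ℂ) * I))‖ ≤ |Real.tan φ| ∧ |Real.tan φ| ≤ 1 ∧ |φ| ≤ |θ| := by
    intro φ hφ
    obtain ⟨hφθ, hksin⟩ := arc_angle_props k hs hφ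
    have hφ4 : |φ| ≤ π / 4 := by linarith
    have hcos : 0 < Real.cos φ := Real.cos_pos_of_mem_Ioo ⟨by linarith [abs_le.1 hφ4], by linarith [abs_le.1 hφ4]⟩
    exact ⟨norm_slitEc_zpow_arc_le k hksin, norm_slitYc_arc_le hcos, abs_tan_le_one hφ4, hφθ⟩
  have hYs : ∀ φ ∈ uIcc θ 0, ‖slitYc (cexp ((φ : ℂ) * I))‖ ^ s ≤ ‖slitYc (cexp ((φ : ℂ) * I))‖ := by
    intro φ hφ
    obtain ⟨_, hY, ht, _⟩ := hpt φ hφ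
    exact pow_le_of_le_one (norm_nonneg _) (hY.trans ht) (by omega)
  by_cases hks : (s : ℤ) ≤ |k|
  · -- Case `|k| ≥ s`
    have hk0 : 0 < |(k : ℝ)| := by
      have : (1 : ℤ) ≤ |k| := le_trans (by exact_mod_cast hs) hks
      have : (1 : ℝ) ≤ |(k : ℝ)| := by rw [← Int.cast_abs]; exact_mod_cast this
      linarith
    set c := |(k : ℝ)| / 2 with hcdef
    have hc : 0 < c := by positivity
    set B₂ := M * a * Real.exp (-(|(k : ℝ)| / 4)) with hB₂
    have hB₂0 : 0 ≤ B₂ := by positivity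
    set g : ℝ → ℝ := fun φ => 2 * M * (|φ| * Real.exp (-c * |φ|)) + B₂ with hgdef
    have hg_nn : ∀ φ, 0 ≤ g φ := fun φ => by positivity
    have hg_even : ∀ φ, g (-φ) = g φ := fun φ => by simp [hgdef, abs_neg]
    have hg_cont : Continuous g := by fun_prop
    have hg_int : ∀ a b : ℝ, IntervalIntegrable g volume a b := fun a b => hg_cont.intervalIntegrable _ _
    -- pointwise bound
    have hbound : ∀ φ ∈ uIcc θ 0, ‖slitJg Φ k s (cexp ((φ : ℂ) * I)) * (cexp ((φ : ℂ) * I) * I)‖ ≤ g φ := by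
      intro φ hφ
      obtain ⟨hE, hY, ht, hφθ⟩ := hpt φ hφ
      have hφ4 : |φ| ≤ π / 4 := by linarith
      rw [hF φ]
      rcases le_or_gt |φ| (π / 8) with h8 | h8
      · -- near the axis: `≤ 2M|φ|e^{-c|φ|}`
        have hΦ := h1 φ hφ h8
        have hE' : ‖slitEc (cexp ((φ : ℂ) * I)) ^ k‖ ≤ Real.exp (-c * |φ|) := by
          refine hE.trans (Real.exp_le_exp.2 ?_)
          rw [hcdef]
          have := abs_le_abs_sin_two_mul hφ4
          nlinarith [abs_nonneg (k : ℝ)]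
        have hY' : ‖slitYc (cexp ((φ : ℂ) * I))‖ ^ s ≤ 2 * |φ| :=
          ((hYs φ hφ).trans hY).trans (abs_tan_le_two_mul_abs hφ4)
        calc ‖slitEc (cexp ((φ : ℂ) * I)) ^ k‖ * ‖slitYc (cexp ((φ : ℂ) * I))‖ ^ s * ‖Φ (cexp ((φ : ℂ) * I))‖
            ≤ Real.exp (-c * |φ|) * (2 * |φ|) * M := by
              apply mul_le_mul (mul_le_mul hE' hY' (by positivity) (Real.exp_pos _).le) hΦ (norm_nonneg _)
              positivity
          _ = 2 * M * (|φ| * Real.exp (-c * |φ|)) := by ring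
          _ ≤ g φ := by simp only [hgdef]; linarith
      · -- away from the axis: `≤ B₂`
        have hΦ := h2 φ hφ
        have hsin := sin_pi_div_four_le_abs_sin h8.le hφ4
        have hs2 : (1 : ℝ) / 2 ≤ Real.sqrt 2 / 2 := by
          have : (1 : ℝ) ≤ Real.sqrt 2 := Real.one_le_sqrt.2 (by norm_num); linarith
        have hE' : ‖slitEc (cexp ((φ : ℂ) * I)) ^ k‖ ≤ Real.exp (-(|(k : ℝ)| / 4)) := by
          refine hE.trans (Real.exp_le_exp.2 ?_)
          nlinarith [abs_nonneg (k : ℝ)]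
        have hY' : ‖slitYc (cexp ((φ : ℂ) * I))‖ ^ s ≤ 1 := (hYs φ hφ).trans (hY.trans ht)
        calc ‖slitEc (cexp ((φ : ℂ) * I)) ^ k‖ * ‖slitYc (cexp ((φ : ℂ) * I))‖ ^ s * ‖Φ (cexp ((φ : ℂ) * I))‖
            ≤ Real.exp (-(|(k : ℝ)| / 4)) * 1 * (M * a) := by
              apply mul_le_mul (mul_le_mul hE' hY' (by positivity) (Real.exp_pos _).le) hΦ (norm_nonneg _)
              positivity
          _ = B₂ := by rw [hB₂]; ring
          _ ≤ g φ := by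
              have h0 : 0 ≤ 2 * M * (|φ| * Real.exp (-c * |φ|)) := by positivity
              simp only [hgdef]; linarith
    -- integrate
    have hint := intervalIntegral.norm_integral_le_abs_of_norm_le (μ := volume) (a := θ) (b := 0)
      (f := fun φ => slitJg Φ k s (cexp ((φ : ℂ) * I)) * (cexp ((φ : ℂ) * I) * I)) (g := g)
      (by
        rw [ae_restrict_iff' measurableSet_uIoc]
        exact Eventually.of_forall fun φ hφ => hbound φ (uIoc_subset_uIcc hφ))
      (hg_int θ 0)
    refine hint.trans ?_
    rw [abs_integral_to_zero_of_even hg_even hg_nn θ]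
    -- `∫_0^{|θ|} g = 2M ∫_0^{|θ|} ψ e^{-cψ} + B₂ |θ|`
    have hsplit : ∫ x in (0 : ℝ)..|θ|, g x = 2 * M * (∫ x in (0 : ℝ)..|θ|, x * Real.exp (-c * x)) + B₂ * |θ| := by
      have h1 : ∫ x in (0 : ℝ)..|θ|, g x = ∫ x in (0 : ℝ)..|θ|, (2 * M * (x * Real.exp (-c * x)) + B₂) := by
        refine intervalIntegral.integral_congr fun x hx => ?_
        rw [uIcc_of_le (abs_nonneg θ)] at hx
        simp only [hgdef, abs_of_nonneg hx.1]
      rw [h1, intervalIntegral.integral_add ((by fun_prop : Continuous fun x : ℝ => 2 * M * (x * Real.exp (-c * x))).intervalIntegrable _ _)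
        (intervalIntegrable_const), intervalIntegral.integral_const_mul, intervalIntegral.integral_const]
      simp only [sub_zero, smul_eq_mul]
      ring
    rw [hsplit]
    have hI := integral_mul_exp_neg_le hc (abs_nonneg θ)
    -- `2M/c² = 8M/k² ≤ 18 M/a²`
    have hk2 : 1 / c ^ 2 ≤ 9 / a ^ 2 := by
      rw [hcdef, div_pow, div_le_div_iff₀ (by positivity) (by positivity)]
      have := norm_sq_le_of_le k s hks
      rw [← hadef] at this
      have h2 : |(k : ℝ)| ^ 2 = (k : ℝ) ^ 2 := sq_abs _
      nlinarith
    -- `B₂ ≤ 1296 M/a²`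
    have hB : B₂ ≤ 1296 * M / a ^ 2 := by
      have hka : a ≤ 3 / 2 * |(k : ℝ)| := by
        have := norm_sq_le_of_le k s hks
        rw [← hadef] at this
        nlinarith [abs_nonneg (k : ℝ), sq_abs (k : ℝ)]
      have he : Real.exp (-(|(k : ℝ)| / 4)) ≤ Real.exp (-(a / 6)) := Real.exp_le_exp.2 (by linarith)
      have hp := pow_mul_exp_neg_div_le 3 (m := 6) (x := a) (by norm_num) ha0.le
      have h3 : a * Real.exp (-(a / 6)) ≤ 1296 / a ^ 2 := by
        rw [le_div_iff₀ (by positivity)]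
        have : (Nat.factorial 3 : ℝ) = 6 := by norm_num [Nat.factorial]
        rw [this] at hp
        nlinarith [Real.exp_pos (-(a / 6))]
      calc B₂ = M * (a * Real.exp (-(|(k : ℝ)| / 4))) := by rw [hB₂]; ring
        _ ≤ M * (a * Real.exp (-(a / 6))) := by gcongr
        _ ≤ M * (1296 / a ^ 2) := by gcongr
        _ = 1296 * M / a ^ 2 := by ring
    calc 2 * M * (∫ x in (0 : ℝ)..|θ|, x * Real.exp (-c * x)) + B₂ * |θ|
        ≤ 2 * M * (1 / c ^ 2) + B₂ * 1 := by gcongr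
      _ ≤ 2 * M * (9 / a ^ 2) + 1296 * M / a ^ 2 := by rw [mul_one]; gcongr
      _ = 1314 * M / a ^ 2 := by ring
      _ ≤ 1400 * M / a ^ 2 := by gcongr; norm_num
  · -- Case `|k| < s`: the whole arc is within `|φ| < π/8`
    have hks : |k| < (s : ℤ) := lt_of_not_ge hks
    have hθ8 : |θ| < π / 8 := abs_rotAngle_lt_of_lt k hs hks
    have hbound : ∀ φ ∈ Ι θ 0, ‖slitJg Φ k s (cexp ((φ : ℂ) * I)) * (cexp ((φ : ℂ) * I) * I)‖ ≤ (1 / 2) ^ s * M := by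
      intro φ hφ'
      have hφ : φ ∈ uIcc θ 0 := uIoc_subset_uIcc hφ'
      obtain ⟨hE, hY, _, hφθ⟩ := hpt φ hφ
      have h8 : |φ| ≤ π / 8 := by linarith
      have hΦ := h1 φ hφ h8
      have hE' : ‖slitEc (cexp ((φ : ℂ) * I)) ^ k‖ ≤ 1 := by
        refine hE.trans ?_
        rw [Real.exp_le_one_iff]
        have : 0 ≤ |(k : ℝ)| * |Real.sin (2 * φ)| / 2 := by positivity
        linarith
      have hY' : ‖slitYc (cexp ((φ : ℂ) * I))‖ ^ s ≤ (1 / 2) ^ s :=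
        pow_le_pow_left₀ (norm_nonneg _) (hY.trans (abs_tan_le_half h8)) s
      rw [hF φ]
      calc ‖slitEc (cexp ((φ : ℂ) * I)) ^ k‖ * ‖slitYc (cexp ((φ : ℂ) * I))‖ ^ s * ‖Φ (cexp ((φ : ℂ) * I))‖
          ≤ 1 * (1 / 2) ^ s * M := by
            apply mul_le_mul (mul_le_mul hE' hY' (by positivity) zero_le_one) hΦ (norm_nonneg _)
            positivity
        _ = (1 / 2) ^ s * M := by ring
    have hint := intervalIntegral.norm_integral_le_of_norm_le_const hbound
    refine hint.trans ?_
    rw [zero_sub, abs_neg]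
    have hhalf := half_pow_le hs
    have hs2 : a ^ 2 ≤ 2 * (s : ℝ) ^ 2 := by
      rw [hadef, norm_slitParam_sq]
      have hks' : |(k : ℝ)| < s := by
        have : ((|k| : ℤ) : ℝ) < ((s : ℤ) : ℝ) := by exact_mod_cast hks
        simpa using this
      have h2 : |(k : ℝ)| ^ 2 = (k : ℝ) ^ 2 := sq_abs _
      nlinarith [abs_nonneg (k : ℝ)]
    have hspos : (0 : ℝ) < (s : ℝ) ^ 2 := by positivity
    have hfrac : 2 / (s : ℝ) ^ 2 ≤ 4 / a ^ 2 := by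
      rw [div_le_div_iff₀ hspos (by positivity)]
      nlinarith
    calc (1 / 2 : ℝ) ^ s * M * |θ| ≤ 2 / (s : ℝ) ^ 2 * M * 1 := by gcongr
      _ ≤ 4 / a ^ 2 * M * 1 := mul_le_mul_of_nonneg_right (mul_le_mul_of_nonneg_right hfrac hM) zero_le_one
      _ = 4 * M / a ^ 2 := by ring
      _ ≤ 1400 * M / a ^ 2 := by gcongr; norm_num

/-! ### The ray: cut-off `w₀ = ‖a‖^{-1/4}/2`, far piece, Taylor piece -/

/-- The cut-off radius `w₀ = ‖a‖^{-1/4}/2`. [folklore] -/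
def slitCutoff (k : ℤ) (s : ℕ) : ℝ := ‖slitParam k s‖ ^ (-(1 / 4 : ℝ)) / 2

/-- Basic facts on `w₀`: `0 < w₀ ≤ 1/2`, `w₀² = n^{-1/2}/4`, `n w₀² = √n/4`, `n w₀⁶ = n^{-1/2}/64 ≤ 1/64`. [folklore] -/
theorem slitCutoff_props (k : ℤ) {s : ℕ} (hs : 1 ≤ s) :
    0 < slitCutoff k s ∧ slitCutoff k s ≤ 1 / 2 ∧
    ‖slitParam k s‖ * slitCutoff k s ^ 2 = Real.sqrt ‖slitParam k s‖ / 4 ∧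
    ‖slitParam k s‖ * slitCutoff k s ^ 6 ≤ 1 / 64 ∧
    1 / slitCutoff k s ≤ 2 * ‖slitParam k s‖ := by
  set n := ‖slitParam k s‖ with hn
  have hn1 : 1 ≤ n := one_le_norm_slitParam k hs
  have hn0 : 0 < n := by linarith
  have hq : 0 < n ^ (-(1 / 4 : ℝ)) := Real.rpow_pos_of_pos hn0 _
  have hq1 : n ^ (-(1 / 4 : ℝ)) ≤ 1 := Real.rpow_le_one_of_one_le_of_nonpos hn1 (by norm_num)
  have hq2 : (n ^ (-(1 / 4 : ℝ))) ^ 2 = n ^ (-(1 / 2 : ℝ)) := by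
    rw [← Real.rpow_natCast, ← Real.rpow_mul hn0.le]; norm_num
  have hq6 : (n ^ (-(1 / 4 : ℝ))) ^ 6 = n ^ (-(3 / 2 : ℝ)) := by
    rw [← Real.rpow_natCast, ← Real.rpow_mul hn0.le]; norm_num
  have hsqrt : Real.sqrt n = n ^ (1 / 2 : ℝ) := Real.sqrt_eq_rpow n
  have hhalf : n * n ^ (-(1 / 2 : ℝ)) = n ^ (1 / 2 : ℝ) := by
    have h := Real.rpow_add hn0 1 (-(1 / 2 : ℝ))
    rw [Real.rpow_one] at h
    rw [← h]; norm_num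
  have h32 : n * n ^ (-(3 / 2 : ℝ)) = n ^ (-(1 / 2 : ℝ)) := by
    rw [show (-(1 / 2) : ℝ) = 1 + (-(3 / 2 : ℝ)) by norm_num, Real.rpow_add hn0, Real.rpow_one]
  have hm12 : n ^ (-(1 / 2 : ℝ)) ≤ 1 := Real.rpow_le_one_of_one_le_of_nonpos hn1 (by norm_num)
  have hquarter : n ^ (1 / 4 : ℝ) ≤ n := by
    calc n ^ (1 / 4 : ℝ) ≤ n ^ (1 : ℝ) := Real.rpow_le_rpow_of_exponent_le hn1 (by norm_num)
      _ = n := Real.rpow_one n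
  refine ⟨by unfold slitCutoff; positivity, by unfold slitCutoff; linarith, ?_, ?_, ?_⟩
  · unfold slitCutoff; rw [div_pow, hq2, hsqrt, ← hhalf]; ring
  · unfold slitCutoff; rw [div_pow, hq6]
    have : n * (n ^ (-(3 / 2 : ℝ)) / 2 ^ 6) = n ^ (-(1 / 2 : ℝ)) / 64 := by rw [← h32]; ring
    rw [this]; linarith
  · unfold slitCutoff
    rw [one_div_div, Real.rpow_neg hn0.le, div_inv_eq_mul]
    linarith

/-- **The far piece of the ray**: `‖∫_{w₀}^1 f(we^{iθ_a}) dw‖ ≤ M‖a‖ e^{-√‖a‖/8}` when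
`‖Φ‖ ≤ M‖a‖` on the ray. [folklore] -/
theorem norm_ray_far_le {Φ : ℂ → ℂ} {M : ℝ} (hM : 0 ≤ M) (k : ℤ) {s : ℕ} (hs : 1 ≤ s)
    (hΦ : ∀ w ∈ Icc (0 : ℝ) 1, ‖Φ ((w : ℂ) * cexp ((rotAngle k s : ℂ) * I))‖ ≤ M * ‖slitParam k s‖) :
    ‖∫ w in (slitCutoff k s)..1, slitJg Φ k s ((w : ℂ) * cexp ((rotAngle k s : ℂ) * I))‖ ≤
      M * ‖slitParam k s‖ * Real.exp (-(Real.sqrt ‖slitParam k s‖ / 8)) := by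
  obtain ⟨hw0, hw1, hnw2, _, _⟩ := slitCutoff_props k hs
  set n := ‖slitParam k s‖ with hn
  set w₀ := slitCutoff k s with hw₀
  have hn1 : 1 ≤ n := one_le_norm_slitParam k hs
  have hbound : ∀ w ∈ Ι w₀ 1, ‖slitJg Φ k s ((w : ℂ) * cexp ((rotAngle k s : ℂ) * I))‖ ≤
      Real.exp (-(Real.sqrt n / 8)) * (M * n) := by
    intro w hw
    rw [uIoc_of_le (by linarith)] at hw
    have hw' : w ∈ Icc (0 : ℝ) 1 := ⟨by linarith [hw.1], hw.2⟩
    rw [slitJg, norm_mul]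
    refine mul_le_mul ?_ (hΦ w hw') (norm_nonneg _) (Real.exp_pos _).le
    refine (norm_slitEc_zpow_mul_slitYc_pow_le k hs w).trans (Real.exp_le_exp.2 ?_)
    rw [← hn]
    -- `n w²/(1 + w⁴) ≥ n w₀²/2 = √n/8`
    have h1 : 1 + w ^ 4 ≤ 2 := by nlinarith [hw.1, hw.2, pow_le_one₀ (n := 4) (by linarith [hw.1] : (0:ℝ) ≤ w) hw.2]
    have h2 : w₀ ^ 2 ≤ w ^ 2 := pow_le_pow_left₀ hw0.le hw.1.le 2
    have h3 : n * w₀ ^ 2 / 2 ≤ n * w ^ 2 / (1 + w ^ 4) := by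
      rw [div_le_div_iff₀ (by norm_num) (by positivity)]
      have hh : w₀ ^ 2 * (1 + w ^ 4) ≤ w ^ 2 * 2 := mul_le_mul h2 h1 (by positivity) (by positivity)
      calc n * w₀ ^ 2 * (1 + w ^ 4) = n * (w₀ ^ 2 * (1 + w ^ 4)) := by ring
        _ ≤ n * (w ^ 2 * 2) := mul_le_mul_of_nonneg_left hh (by linarith)
        _ = n * w ^ 2 * 2 := by ring
    rw [hnw2] at h3
    linarith
  have h := intervalIntegral.norm_integral_le_of_norm_le_const hbound
  refine h.trans ?_
  rw [abs_of_nonneg (by linarith)]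
  have : 0 ≤ Real.exp (-(Real.sqrt n / 8)) * (M * n) := by positivity
  nlinarith

/-- **The Taylor estimate on the near piece of the ray**: for `0 ≤ w ≤ w₀`,
`‖f(we^{iθ_a}) - e^{-2‖a‖w²}(c₀ + c₂ e^{2iθ_a} w²)‖ ≤ e^{-2‖a‖w²}(12 M‖a‖w⁶ + M w⁴)`. [folklore] -/
theorem norm_ray_near_sub_le {Φ : ℂ → ℂ} {M : ℝ} {c₀ c₂ : ℂ} (hM : 0 ≤ M) (hc₀ : ‖c₀‖ ≤ M) (hc₂ : ‖c₂‖ ≤ M)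
    (hT : ∀ v : ℂ, ‖v‖ ≤ 1 / 2 → ‖Φ v - (c₀ + c₂ * v ^ 2)‖ ≤ M * ‖v‖ ^ 4)
    (k : ℤ) {s : ℕ} (hs : 1 ≤ s) {w : ℝ} (hw0 : 0 ≤ w) (hw1 : w ≤ slitCutoff k s) :
    ‖slitJg Φ k s ((w : ℂ) * cexp ((rotAngle k s : ℂ) * I)) -
        ((Real.exp (-2 * ‖slitParam k s‖ * w ^ 2) : ℝ) : ℂ) * (c₀ + c₂ * cexp ((rotAngle k s : ℂ) * I) ^ 2 * w ^ 2)‖ ≤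
      Real.exp (-2 * ‖slitParam k s‖ * w ^ 2) * (12 * M * ‖slitParam k s‖ * w ^ 6 + M * w ^ 4) := by
  obtain ⟨hc0, hc1, _, hnw6, _⟩ := slitCutoff_props k hs
  set n := ‖slitParam k s‖ with hn
  set θ := rotAngle k s with hθ
  set v : ℂ := (w : ℂ) * cexp ((θ : ℂ) * I) with hv
  have hn1 : 1 ≤ n := one_le_norm_slitParam k hs
  have hnv : ‖v‖ = w := by rw [hv, norm_mul, Complex.norm_real, Complex.norm_exp_ofReal_mul_I, mul_one, Real.norm_eq_abs, abs_of_nonneg hw0]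
  have hwh : w ≤ 1 / 2 := hw1.trans hc1
  have hv2 : ‖v‖ ^ 2 ≤ 1 / 3 := by rw [hnv]; nlinarith
  have hv1 : ‖v‖ < 1 := by rw [hnv]; linarith
  -- the phase
  have hexp := slitEc_zpow_mul_slitYc_pow_eq_exp k s hv1
  set R := (k : ℂ) * logE v + (s : ℂ) * logY v + 2 * slitParam k s * v ^ 2 with hR
  have hRle : ‖R‖ ≤ 2 * n * w ^ 6 := by
    refine (norm_phase_remainder_le k s hv2).trans ?_
    rw [hnv]
    have := abs_add_le_two_mul_norm k s
    rw [← hn] at this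
    have h6 : 0 ≤ w ^ 6 := by positivity
    nlinarith
  have hw6 : n * w ^ 6 ≤ 1 / 64 := by
    have : w ^ 6 ≤ slitCutoff k s ^ 6 := pow_le_pow_left₀ hw0 hw1 6
    nlinarith
  have hR1 : ‖R‖ ≤ 1 := by linarith
  have hsq : slitParam k s * v ^ 2 = (n : ℂ) * (w : ℂ) ^ 2 := by
    rw [hv, hn]
    have := slitParam_mul_ray_sq k s w
    push_cast at this
    exact this
  have hphase : (k : ℂ) * logE v + (s : ℂ) * logY v = ((-2 * n * w ^ 2 : ℝ) : ℂ) + R := by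
    rw [hR]; push_cast
    linear_combination (-2 : ℂ) * hsq
  have hEY : slitEc v ^ k * slitYc v ^ s = ((Real.exp (-2 * n * w ^ 2) : ℝ) : ℂ) * cexp R := by
    rw [hexp, hphase, Complex.exp_add, Complex.ofReal_exp]
  -- the amplitude
  have hΦT := hT v (by rw [hnv]; exact hwh)
  have hΦn : ‖Φ v‖ ≤ 3 * M := by
    have h1 : ‖Φ v‖ ≤ ‖c₀ + c₂ * v ^ 2‖ + M * ‖v‖ ^ 4 := by
      have := norm_sub_norm_le (Φ v) (c₀ + c₂ * v ^ 2); linarith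
    have h2 : ‖c₀ + c₂ * v ^ 2‖ ≤ M + M * w ^ 2 := by
      refine (norm_add_le _ _).trans (add_le_add hc₀ ?_)
      rw [norm_mul, norm_pow, hnv]; exact mul_le_mul_of_nonneg_right hc₂ (by positivity)
    rw [hnv] at h1
    have hw2 : w ^ 2 ≤ 1 := by nlinarith
    have hw4 : w ^ 4 ≤ 1 := by nlinarith
    nlinarith
  have hexpR : ‖cexp R - 1‖ ≤ 2 * ‖R‖ := Complex.norm_exp_sub_one_le hR1
  -- assemble: f - model = e^{-2nw²} [ (e^R - 1) Φ + (Φ - (c₀ + c₂ v²)) ]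
  have hv2' : cexp ((θ : ℂ) * I) ^ 2 * (w : ℂ) ^ 2 = v ^ 2 := by rw [hv]; ring
  have key : slitJg Φ k s v - ((Real.exp (-2 * n * w ^ 2) : ℝ) : ℂ) * (c₀ + c₂ * cexp ((θ : ℂ) * I) ^ 2 * (w : ℂ) ^ 2) =
      ((Real.exp (-2 * n * w ^ 2) : ℝ) : ℂ) * ((cexp R - 1) * Φ v + (Φ v - (c₀ + c₂ * v ^ 2))) := by
    rw [slitJg, hEY, mul_assoc c₂, hv2']; ring
  rw [key, norm_mul, Complex.norm_real, Real.norm_eq_abs, abs_of_pos (Real.exp_pos _)]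
  refine mul_le_mul_of_nonneg_left ?_ (Real.exp_pos _).le
  refine (norm_add_le _ _).trans ?_
  rw [norm_mul]
  have h1 : ‖cexp R - 1‖ * ‖Φ v‖ ≤ (2 * (2 * n * w ^ 6)) * (3 * M) :=
    mul_le_mul (hexpR.trans (by linarith)) hΦn (norm_nonneg _) (by positivity)
  rw [hnv] at hΦT
  nlinarith

/-! ### The ray: integrating the Taylor estimate, the model integral, the tails -/

/-- `∫_0^{x} g = ∫_{(0,∞)} g - ∫_{(x,∞)} g` for `g` integrable on `(0,∞)`, `x ≥ 0`. [folklore] -/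
theorem intervalIntegral_eq_Ioi_sub_Ioi {g : ℝ → ℝ} {x : ℝ} (hx : 0 ≤ x) (hg : IntegrableOn g (Ioi 0)) :
    ∫ w in (0 : ℝ)..x, g w = (∫ w in Ioi (0 : ℝ), g w) - ∫ w in Ioi x, g w := by
  have hunion := (Set.Ioc_union_Ioi_eq_Ioi hx : Ioc 0 x ∪ Ioi x = Ioi 0)
  have hdisj : Disjoint (Ioc 0 x) (Ioi x) := by
    rw [Set.disjoint_left]; intro w hw hw'; exact (not_lt.2 hw.2) hw'
  have h := MeasureTheory.setIntegral_union hdisj measurableSet_Ioi (hg.mono_set Ioc_subset_Ioi_self)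
    (hg.mono_set (Ioi_subset_Ioi hx))
  rw [hunion] at h
  rw [intervalIntegral.integral_of_le hx, h]
  ring

/-- **Integrating the Taylor estimate**: the near piece of the ray differs from the model integral
by at most `6M/‖a‖²`. [folklore] -/
theorem norm_ray_near_sub_model_le {Φ : ℂ → ℂ} {M : ℝ} {c₀ c₂ : ℂ} (hM : 0 ≤ M) (hc₀ : ‖c₀‖ ≤ M) (hc₂ : ‖c₂‖ ≤ M)
    (hT : ∀ v : ℂ, ‖v‖ ≤ 1 / 2 → ‖Φ v - (c₀ + c₂ * v ^ 2)‖ ≤ M * ‖v‖ ^ 4) (k : ℤ) {s : ℕ} (hs : 1 ≤ s) :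
    ‖∫ w in (0 : ℝ)..slitCutoff k s, (slitJg Φ k s ((w : ℂ) * cexp ((rotAngle k s : ℂ) * I)) -
        ((Real.exp (-2 * ‖slitParam k s‖ * w ^ 2) : ℝ) : ℂ) * (c₀ + c₂ * cexp ((rotAngle k s : ℂ) * I) ^ 2 * w ^ 2))‖ ≤
      6 * M / ‖slitParam k s‖ ^ 2 := by
  obtain ⟨hc0, hc1, _, _, _⟩ := slitCutoff_props k hs
  set n := ‖slitParam k s‖ with hn
  set w₀ := slitCutoff k s with hw₀
  have hn1 : 1 ≤ n := one_le_norm_slitParam k hs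
  have hn0 : 0 < n := by linarith
  have hb : 0 < 2 * n := by linarith
  set g : ℝ → ℝ := fun w => Real.exp (-(2 * n) * w ^ 2) * (12 * M * n * w ^ 6 + M * w ^ 4) with hg
  have hbound : ∀ᵐ w ∂volume, w ∈ Ioc 0 w₀ → ‖slitJg Φ k s ((w : ℂ) * cexp ((rotAngle k s : ℂ) * I)) -
      ((Real.exp (-2 * n * w ^ 2) : ℝ) : ℂ) * (c₀ + c₂ * cexp ((rotAngle k s : ℂ) * I) ^ 2 * w ^ 2)‖ ≤ g w := by
    refine Eventually.of_forall fun w hw => ?_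
    have h := norm_ray_near_sub_le hM hc₀ hc₂ hT k hs hw.1.le hw.2
    rw [← hn] at h
    refine h.trans (le_of_eq ?_)
    simp only [hg]; ring_nf
  have hgcont : Continuous g := by fun_prop
  have h1 := intervalIntegral.norm_integral_le_of_norm_le hc0.le hbound (hgcont.intervalIntegrable _ _)
  refine h1.trans ?_
  -- `∫_0^{w₀} g ≤ ∫_{(0,∞)} g = 12 M n I₆ + M I₄`
  have hI6 := integrableOn_pow_mul_exp_neg_mul_sq 6 hb
  have hI4 := integrableOn_pow_mul_exp_neg_mul_sq 4 hb
  have hgI : IntegrableOn g (Ioi 0) := by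
    have : g = fun w => 12 * M * n * (w ^ 6 * Real.exp (-(2 * n) * w ^ 2)) + M * (w ^ 4 * Real.exp (-(2 * n) * w ^ 2)) := by
      funext w; simp only [hg]; ring
    rw [this]
    exact (hI6.const_mul _).add (hI4.const_mul _)
  have h2 : ∫ w in (0 : ℝ)..w₀, g w ≤ ∫ w in Ioi (0 : ℝ), g w := by
    rw [intervalIntegral.integral_of_le hc0.le]
    exact setIntegral_mono_set hgI (Eventually.of_forall fun w => by simp only [hg]; positivity)
      (Eventually.of_forall Ioc_subset_Ioi_self)
  refine h2.trans ?_
  have h3 : ∫ w in Ioi (0 : ℝ), g w = 12 * M * n * (∫ w in Ioi (0 : ℝ), w ^ 6 * Real.exp (-(2 * n) * w ^ 2)) +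
      M * ∫ w in Ioi (0 : ℝ), w ^ 4 * Real.exp (-(2 * n) * w ^ 2) := by
    have : g = fun w => 12 * M * n * (w ^ 6 * Real.exp (-(2 * n) * w ^ 2)) + M * (w ^ 4 * Real.exp (-(2 * n) * w ^ 2)) := by
      funext w; simp only [hg]; ring
    rw [this, integral_add (hI6.const_mul _) (hI4.const_mul _), MeasureTheory.integral_const_mul, MeasureTheory.integral_const_mul]
  rw [h3]
  have h6 := integral_pow_mul_exp_neg_mul_sq_le 6 hb
  have h4 := integral_pow_mul_exp_neg_mul_sq_le 4 hb
  -- Gamma values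
  have hG52 : Real.Gamma ((((4 : ℕ) : ℝ) + 1) / 2) = 3 / 4 * Real.sqrt π := by
    rw [show ((((4 : ℕ) : ℝ) + 1) / 2) = 3 / 2 + 1 by norm_num, Real.Gamma_add_one (by norm_num), Real_Gamma_three_halves]; ring
  have hG72 : Real.Gamma ((((6 : ℕ) : ℝ) + 1) / 2) = 15 / 8 * Real.sqrt π := by
    rw [show ((((6 : ℕ) : ℝ) + 1) / 2) = 3 / 2 + 1 + 1 by norm_num, Real.Gamma_add_one (by norm_num),
      Real.Gamma_add_one (by norm_num), Real_Gamma_three_halves]; ring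
  have hsqrtπ : Real.sqrt π ≤ 1.78 := by
    rw [Real.sqrt_le_left (by norm_num)]; have := Real.pi_lt_d2; nlinarith
  -- powers of `b = 2n ≥ 1`
  have hb1 : 1 ≤ 2 * n := by linarith
  have hp6 : (2 * n) ^ (-((((6 : ℕ) : ℝ)) + 1) / 2) ≤ 1 / (8 * n ^ 3) := by
    calc (2 * n) ^ (-((((6 : ℕ) : ℝ)) + 1) / 2) ≤ (2 * n) ^ (-(3 : ℝ)) :=
          Real.rpow_le_rpow_of_exponent_le hb1 (by norm_num)
      _ = 1 / (8 * n ^ 3) := by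
          rw [Real.rpow_neg hb.le, show (3 : ℝ) = ((3 : ℕ) : ℝ) by norm_num, Real.rpow_natCast]; field_simp; ring
  have hp4 : (2 * n) ^ (-((((4 : ℕ) : ℝ)) + 1) / 2) ≤ 1 / (4 * n ^ 2) := by
    calc (2 * n) ^ (-((((4 : ℕ) : ℝ)) + 1) / 2) ≤ (2 * n) ^ (-(2 : ℝ)) :=
          Real.rpow_le_rpow_of_exponent_le hb1 (by norm_num)
      _ = 1 / (4 * n ^ 2) := by
          rw [Real.rpow_neg hb.le, show (2 : ℝ) = ((2 : ℕ) : ℝ) by norm_num, Real.rpow_natCast]; field_simp; ring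
  rw [hG72] at h6
  rw [hG52] at h4
  have hI6le : ∫ w in Ioi (0 : ℝ), w ^ 6 * Real.exp (-(2 * n) * w ^ 2) ≤ 15 / 8 * 1.78 * (1 / (8 * n ^ 3)) := by
    refine h6.trans ?_
    exact mul_le_mul (by nlinarith [Real.sqrt_nonneg π]) hp6 (Real.rpow_nonneg hb.le _) (by positivity)
  have hI4le : ∫ w in Ioi (0 : ℝ), w ^ 4 * Real.exp (-(2 * n) * w ^ 2) ≤ 3 / 4 * 1.78 * (1 / (4 * n ^ 2)) := by
    refine h4.trans ?_
    exact mul_le_mul (by nlinarith [Real.sqrt_nonneg π]) hp4 (Real.rpow_nonneg hb.le _) (by positivity)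
  have hn3 : n ^ 3 = n * n ^ 2 := by ring
  calc 12 * M * n * (∫ w in Ioi (0 : ℝ), w ^ 6 * Real.exp (-(2 * n) * w ^ 2)) +
        M * ∫ w in Ioi (0 : ℝ), w ^ 4 * Real.exp (-(2 * n) * w ^ 2)
      ≤ 12 * M * n * (15 / 8 * 1.78 * (1 / (8 * n ^ 3))) + M * (3 / 4 * 1.78 * (1 / (4 * n ^ 2))) := by
        gcongr
    _ = (12 * 15 / 8 * 1.78 / 8 + 3 / 4 * 1.78 / 4) * M / n ^ 2 := by rw [hn3]; field_simp
    _ ≤ 6 * M / n ^ 2 := by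
        apply div_le_div_of_nonneg_right _ (by positivity)
        nlinarith

/-- **The model integral on `[0, w₀]`**:
`∫_0^{w₀} e^{-2nw²}(c₀ + c₂e^{2iθ}w²) dw = c₀(G₀ - T₀) + c₂e^{2iθ}(G₂ - T₂)`. [folklore] -/
theorem integral_model_eq (k : ℤ) {s : ℕ} (hs : 1 ≤ s) (c₀ c₂ : ℂ) :
    ∫ w in (0 : ℝ)..slitCutoff k s, ((Real.exp (-2 * ‖slitParam k s‖ * w ^ 2) : ℝ) : ℂ) *
        (c₀ + c₂ * cexp ((rotAngle k s : ℂ) * I) ^ 2 * w ^ 2) =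
      c₀ * (((∫ w in Ioi (0 : ℝ), Real.exp (-(2 * ‖slitParam k s‖) * w ^ 2)) -
          ∫ w in Ioi (slitCutoff k s), Real.exp (-(2 * ‖slitParam k s‖) * w ^ 2) : ℝ) : ℂ) +
      c₂ * cexp ((rotAngle k s : ℂ) * I) ^ 2 *
        (((∫ w in Ioi (0 : ℝ), w ^ 2 * Real.exp (-(2 * ‖slitParam k s‖) * w ^ 2)) -
          ∫ w in Ioi (slitCutoff k s), w ^ 2 * Real.exp (-(2 * ‖slitParam k s‖) * w ^ 2) : ℝ) : ℂ) := by
  obtain ⟨hc0, _, _, _, _⟩ := slitCutoff_props k hs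
  set n := ‖slitParam k s‖ with hn
  set w₀ := slitCutoff k s with hw₀
  set e2 := cexp ((rotAngle k s : ℂ) * I) ^ 2 with he2
  have hn1 : 1 ≤ n := one_le_norm_slitParam k hs
  have hb : 0 < 2 * n := by linarith
  have hI0 := (integrable_exp_neg_mul_sq hb).integrableOn (s := Ioi 0)
  have hI2 := integrableOn_pow_mul_exp_neg_mul_sq 2 hb
  rw [← intervalIntegral_eq_Ioi_sub_Ioi hc0.le hI0, ← intervalIntegral_eq_Ioi_sub_Ioi hc0.le hI2,
    ← intervalIntegral.integral_ofReal, ← intervalIntegral.integral_ofReal,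
    ← intervalIntegral.integral_const_mul, ← intervalIntegral.integral_const_mul,
    ← intervalIntegral.integral_add]
  · refine intervalIntegral.integral_congr fun w _ => ?_
    simp only [neg_mul]
    push_cast
    ring
  · exact ((continuous_ofReal.comp (by fun_prop)).const_mul _).intervalIntegrable _ _
  · exact ((continuous_ofReal.comp (by fun_prop)).const_mul _).intervalIntegrable _ _

/-- **The tails are negligible**: both `T₀ = ∫_{w₀}^∞ e^{-2nw²}` and `T₂ = ∫_{w₀}^∞ w² e^{-2nw²}` are
at most `98304/n²`. [folklore] -/
theorem tails_le (k : ℤ) {s : ℕ} (hs : 1 ≤ s) :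
    (∫ w in Ioi (slitCutoff k s), Real.exp (-(2 * ‖slitParam k s‖) * w ^ 2)) ≤ 98304 / ‖slitParam k s‖ ^ 2 ∧
    (∫ w in Ioi (slitCutoff k s), w ^ 2 * Real.exp (-(2 * ‖slitParam k s‖) * w ^ 2)) ≤ 98304 / ‖slitParam k s‖ ^ 2 := by
  obtain ⟨hc0, hc1, hnw2, _, hinv⟩ := slitCutoff_props k hs
  set n := ‖slitParam k s‖ with hn
  set w₀ := slitCutoff k s with hw₀
  have hn1 : 1 ≤ n := one_le_norm_slitParam k hs
  have hn0 : 0 < n := by linarith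
  have hb : 0 < 2 * n := by linarith
  have hbw : 2 * n * w₀ ^ 2 = Real.sqrt n / 2 := by rw [mul_assoc, hnw2]; ring
  have hsq : Real.sqrt n ≤ n := by
    rw [Real.sqrt_le_left hn0.le]; nlinarith
  have hsq0 : 0 ≤ Real.sqrt n := Real.sqrt_nonneg n
  -- `e^{-√n/2} ≤ e^{-√n/8} ≤ 98304/n²`
  have hexp : Real.exp (-(2 * n) * w₀ ^ 2) ≤ Real.exp (-(Real.sqrt n / 8)) := by
    rw [Real.exp_le_exp, neg_mul, hbw]; linarith
  have hmain : Real.exp (-(Real.sqrt n / 8)) ≤ 98304 / n ^ 2 := by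
    have h := pow_mul_exp_neg_sqrt_le 2 hn0.le
    rw [le_div_iff₀ (by positivity)]
    have : (Nat.factorial (2 * 2) : ℝ) = 24 := by norm_num [Nat.factorial]
    rw [this] at h
    nlinarith
  have hw0inv : 1 / w₀ ≤ 2 * n := hinv
  constructor
  · have h := integral_exp_neg_mul_sq_Ioi_le hb hc0
    refine h.trans ?_
    -- `e^{-bw₀²}/(2b w₀) = e^{-bw₀²} (1/w₀)/(4n) ≤ e^{..} 2n/(4n) = e^{..}/2`
    have : Real.exp (-(2 * n) * w₀ ^ 2) / (2 * (2 * n) * w₀) = Real.exp (-(2 * n) * w₀ ^ 2) * (1 / w₀) / (4 * n) := by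
      field_simp; ring
    rw [this]
    calc Real.exp (-(2 * n) * w₀ ^ 2) * (1 / w₀) / (4 * n) ≤ Real.exp (-(Real.sqrt n / 8)) * (2 * n) / (4 * n) := by
          gcongr
      _ = Real.exp (-(Real.sqrt n / 8)) / 2 := by field_simp; ring
      _ ≤ 98304 / n ^ 2 := by linarith [Real.exp_pos (-(Real.sqrt n / 8))]
  · have h := integral_sq_mul_exp_neg_mul_sq_Ioi_le hb hc0
    refine h.trans ?_
    rw [hbw]
    have : Real.exp (-(2 * n) * w₀ ^ 2) * (Real.sqrt n / 2 + 1) / (2 * (2 * n) ^ 2 * w₀) =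
        Real.exp (-(2 * n) * w₀ ^ 2) * (Real.sqrt n / 2 + 1) * (1 / w₀) / (8 * n ^ 2) := by
      field_simp; ring
    rw [this]
    have h32 : Real.sqrt n / 2 + 1 ≤ 3 / 2 * n := by linarith
    calc Real.exp (-(2 * n) * w₀ ^ 2) * (Real.sqrt n / 2 + 1) * (1 / w₀) / (8 * n ^ 2)
        ≤ Real.exp (-(Real.sqrt n / 8)) * (3 / 2 * n) * (2 * n) / (8 * n ^ 2) := by gcongr
      _ = Real.exp (-(Real.sqrt n / 8)) * (3 / 8) := by field_simp
      _ ≤ 98304 / n ^ 2 := by linarith [Real.exp_pos (-(Real.sqrt n / 8))]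

/-! ### Assembly: the asymptotic expansion of `∫_0^1 E^k Y^s Φ` -/

/-- Continuity of `w ↦ (E^kY^sΦ)(w e^{iθ_a})` on `[0, 1]`. [folklore] -/
theorem continuousOn_slitJg_ray {Φ : ℂ → ℂ} (hΦd : ∀ z, z ∉ slitPoles → DifferentiableAt ℂ Φ z) (k : ℤ) {s : ℕ}
    (hs : 1 ≤ s) {a b : ℝ} (ha : 0 ≤ a) (hb : b ≤ 1) (hab : a ≤ b) :
    ContinuousOn (fun w : ℝ => slitJg Φ k s ((w : ℂ) * cexp ((rotAngle k s : ℂ) * I))) (uIcc a b) := by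
  intro w hw
  rw [uIcc_of_le hab] at hw
  have hθ := abs_rotAngle_lt k hs
  have hmem := mem_ball_sectorCentre hθ (by linarith [hw.1]) (by linarith [hw.2]) (left_mem_uIcc (b := (0 : ℝ)))
    (ρ := w) (φ := rotAngle k s)
  have hnp := not_mem_slitPoles_of_mem_ball hθ hmem
  have hd := differentiableAt_slitJg k s hnp (hΦd _ hnp)
  have hray_cont : Continuous fun w : ℝ => (w : ℂ) * cexp ((rotAngle k s : ℂ) * I) := by fun_prop
  have h2 : ContinuousAt (fun w : ℝ => slitJg Φ k s ((w : ℂ) * cexp ((rotAngle k s : ℂ) * I))) w :=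
    ContinuousAt.comp (f := fun w : ℝ => (w : ℂ) * cexp ((rotAngle k s : ℂ) * I)) (x := w) hd.continuousAt
      hray_cont.continuousAt
  exact h2.continuousWithinAt

/-- **The asymptotic expansion of the rotated integral** (the core of Lemma 2.14/2.16's convergence
statements in closed form): for an amplitude `Φ` holomorphic off the singular set, with Taylor data
`(c₀, c₂)` at the origin and the stated bounds on the sector,
`‖∫_0^1 E^kY^sΦ - e^{iθ_a}(c₀ G₀ + c₂ e^{2iθ_a} G₂)‖ ≤ 2·10⁸ M/‖a‖²`, where
`G₀ = ∫_0^∞ e^{-2‖a‖w²} dw`, `G₂ = ∫_0^∞ w² e^{-2‖a‖w²} dw`. [folklore] -/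
theorem norm_integral_slitJg_sub_main_le {Φ : ℂ → ℂ} {M : ℝ} {c₀ c₂ : ℂ} (hM : 0 ≤ M) (hc₀ : ‖c₀‖ ≤ M)
    (hc₂ : ‖c₂‖ ≤ M) (hΦd : ∀ z, z ∉ slitPoles → DifferentiableAt ℂ Φ z)
    (hT : ∀ v : ℂ, ‖v‖ ≤ 1 / 2 → ‖Φ v - (c₀ + c₂ * v ^ 2)‖ ≤ M * ‖v‖ ^ 4) (k : ℤ) {s : ℕ} (hs : 1 ≤ s)
    (hray : ∀ w ∈ Icc (0 : ℝ) 1, ‖Φ ((w : ℂ) * cexp ((rotAngle k s : ℂ) * I))‖ ≤ M * ‖slitParam k s‖)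
    (harc1 : ∀ φ ∈ uIcc (rotAngle k s) 0, |φ| ≤ π / 8 → ‖Φ (cexp ((φ : ℂ) * I))‖ ≤ M)
    (harc2 : ∀ φ ∈ uIcc (rotAngle k s) 0, ‖Φ (cexp ((φ : ℂ) * I))‖ ≤ M * ‖slitParam k s‖) :
    ‖(∫ t in (0 : ℝ)..1, slitJg Φ k s (t : ℂ)) -
        cexp ((rotAngle k s : ℂ) * I) *
          (c₀ * ((∫ w in Ioi (0 : ℝ), Real.exp (-(2 * ‖slitParam k s‖) * w ^ 2) : ℝ) : ℂ) +
            c₂ * cexp ((rotAngle k s : ℂ) * I) ^ 2 *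
              ((∫ w in Ioi (0 : ℝ), w ^ 2 * Real.exp (-(2 * ‖slitParam k s‖) * w ^ 2) : ℝ) : ℂ))‖ ≤
      200000000 * M / ‖slitParam k s‖ ^ 2 := by
  obtain ⟨hc0, hc1, _, _, _⟩ := slitCutoff_props k hs
  set n := ‖slitParam k s‖ with hn
  set w₀ := slitCutoff k s with hw₀
  set θ := rotAngle k s with hθdef
  set e := cexp ((θ : ℂ) * I) with hedef
  have hn1 : 1 ≤ n := one_le_norm_slitParam k hs
  have hn0 : 0 < n := by linarith
  have hθ : |θ| < π / 4 := abs_rotAngle_lt k hs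
  have he1 : ‖e‖ = 1 := Complex.norm_exp_ofReal_mul_I θ
  set f : ℝ → ℂ := fun w => slitJg Φ k s ((w : ℂ) * e) with hfdef
  set model : ℝ → ℂ := fun w => ((Real.exp (-2 * n * w ^ 2) : ℝ) : ℂ) * (c₀ + c₂ * e ^ 2 * w ^ 2) with hmodel
  set G₀ := ∫ w in Ioi (0 : ℝ), Real.exp (-(2 * n) * w ^ 2) with hG₀
  set G₂ := ∫ w in Ioi (0 : ℝ), w ^ 2 * Real.exp (-(2 * n) * w ^ 2) with hG₂
  set T₀ := ∫ w in Ioi w₀, Real.exp (-(2 * n) * w ^ 2) with hT₀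
  set T₂ := ∫ w in Ioi w₀, w ^ 2 * Real.exp (-(2 * n) * w ^ 2) with hT₂
  set ARC := ∫ φ in θ..0, slitJg Φ k s (cexp ((φ : ℂ) * I)) * (cexp ((φ : ℂ) * I) * I) with hARC
  -- (1) contour
  have hcontour : ∫ t in (0 : ℝ)..1, slitJg Φ k s (t : ℂ) = e * (∫ w in (0 : ℝ)..1, f w) + ARC :=
    integral_slitJg_eq_ray_add_arc hΦd k s hθ
  -- (2) split the ray
  have hint1 : IntervalIntegrable f volume 0 w₀ := (continuousOn_slitJg_ray hΦd k hs le_rfl (by linarith) hc0.le).intervalIntegrable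
  have hint2 : IntervalIntegrable f volume w₀ 1 := (continuousOn_slitJg_ray hΦd k hs hc0.le le_rfl (by linarith)).intervalIntegrable
  have hsplit : ∫ w in (0 : ℝ)..1, f w = (∫ w in (0 : ℝ)..w₀, f w) + ∫ w in w₀..1, f w :=
    (intervalIntegral.integral_add_adjacent_intervals hint1 hint2).symm
  -- (3) near = model + err
  have hmodel_int : IntervalIntegrable model volume 0 w₀ := by
    apply Continuous.intervalIntegrable; simp only [hmodel]; fun_prop
  have hnear : ∫ w in (0 : ℝ)..w₀, f w = (∫ w in (0 : ℝ)..w₀, model w) + ∫ w in (0 : ℝ)..w₀, (f w - model w) := by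
    rw [intervalIntegral.integral_sub hint1 hmodel_int]; ring
  have herr : ‖∫ w in (0 : ℝ)..w₀, (f w - model w)‖ ≤ 6 * M / n ^ 2 :=
    norm_ray_near_sub_model_le hM hc₀ hc₂ hT k hs
  have hmodel_eq : ∫ w in (0 : ℝ)..w₀, model w = c₀ * ((G₀ - T₀ : ℝ) : ℂ) + c₂ * e ^ 2 * ((G₂ - T₂ : ℝ) : ℂ) :=
    integral_model_eq k hs c₀ c₂
  -- (4) far, tails, arc
  have hfar : ‖∫ w in w₀..1, f w‖ ≤ 188743680 * M / n ^ 2 := by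
    refine (norm_ray_far_le hM k hs hray).trans ?_
    rw [← hn]
    have h := pow_mul_exp_neg_sqrt_le 3 hn0.le
    have : (Nat.factorial (2 * 3) : ℝ) = 720 := by norm_num [Nat.factorial]
    rw [this] at h
    rw [le_div_iff₀ (by positivity)]
    have hn3 : n * n ^ 2 = n ^ 3 := by ring
    calc M * n * Real.exp (-(Real.sqrt n / 8)) * n ^ 2 = M * (n ^ 3 * Real.exp (-(Real.sqrt n / 8))) := by ring
      _ ≤ M * (64 ^ 3 * 720) := by gcongr
      _ = 188743680 * M := by ring
  obtain ⟨hT0, hT2⟩ := tails_le k hs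
  have hT0' : T₀ ≤ 98304 / n ^ 2 := hT0
  have hT2' : T₂ ≤ 98304 / n ^ 2 := hT2
  have hT0nn : 0 ≤ T₀ := setIntegral_nonneg measurableSet_Ioi fun w _ => (Real.exp_pos _).le
  have hT2nn : 0 ≤ T₂ := setIntegral_nonneg measurableSet_Ioi fun w _ => by positivity
  have harc : ‖ARC‖ ≤ 1400 * M / n ^ 2 := norm_arc_integral_le hM k hs harc1 harc2
  -- (5) algebra
  have hX : (∫ t in (0 : ℝ)..1, slitJg Φ k s (t : ℂ)) - e * (c₀ * ((G₀ : ℝ) : ℂ) + c₂ * e ^ 2 * ((G₂ : ℝ) : ℂ)) =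
      e * ((∫ w in (0 : ℝ)..w₀, (f w - model w)) + (∫ w in w₀..1, f w) - c₀ * ((T₀ : ℝ) : ℂ) - c₂ * e ^ 2 * ((T₂ : ℝ) : ℂ)) + ARC := by
    rw [hcontour, hsplit, hnear, hmodel_eq]; push_cast; ring
  rw [hX]
  have hY : ‖(∫ w in (0 : ℝ)..w₀, (f w - model w)) + (∫ w in w₀..1, f w) - c₀ * ((T₀ : ℝ) : ℂ) - c₂ * e ^ 2 * ((T₂ : ℝ) : ℂ)‖ ≤
      6 * M / n ^ 2 + 188743680 * M / n ^ 2 + M * (98304 / n ^ 2) + M * (98304 / n ^ 2) := by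
    refine (norm_sub_le _ _).trans (add_le_add ((norm_sub_le _ _).trans (add_le_add ((norm_add_le _ _).trans
      (add_le_add herr hfar)) ?_)) ?_)
    · rw [norm_mul, Complex.norm_real, Real.norm_eq_abs, abs_of_nonneg hT0nn]
      exact mul_le_mul hc₀ hT0' hT0nn hM
    · rw [norm_mul, norm_mul, norm_pow, he1, one_pow, mul_one, Complex.norm_real, Real.norm_eq_abs, abs_of_nonneg hT2nn]
      exact mul_le_mul hc₂ hT2' hT2nn hM
  calc ‖e * ((∫ w in (0 : ℝ)..w₀, (f w - model w)) + (∫ w in w₀..1, f w) - c₀ * ((T₀ : ℝ) : ℂ) - c₂ * e ^ 2 * ((T₂ : ℝ) : ℂ)) + ARC‖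
      ≤ ‖e * ((∫ w in (0 : ℝ)..w₀, (f w - model w)) + (∫ w in w₀..1, f w) - c₀ * ((T₀ : ℝ) : ℂ) - c₂ * e ^ 2 * ((T₂ : ℝ) : ℂ))‖ + ‖ARC‖ :=
        norm_add_le _ _
    _ ≤ (6 * M / n ^ 2 + 188743680 * M / n ^ 2 + M * (98304 / n ^ 2) + M * (98304 / n ^ 2)) + 1400 * M / n ^ 2 := by
        rw [norm_mul, he1, one_mul]; exact add_le_add hY harc
    _ = 188941694 * M / n ^ 2 := by ring
    _ ≤ 200000000 * M / n ^ 2 := by gcongr; norm_num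

/-! ### The amplitude `A = (1 + iz²)⁻¹`: hypotheses of the expansion theorem -/

/-- `A` is differentiable off the singular set. [folklore] -/
theorem differentiableAt_slitAc {z : ℂ} (hz : z ∉ slitPoles) : DifferentiableAt ℂ slitAc z := by
  simp only [slitPoles, mem_setOf_eq, not_or] at hz
  unfold slitAc
  exact ((differentiableAt_const _).add ((differentiableAt_const _).mul (differentiableAt_id.pow 2))).inv hz.1

/-- **Taylor data of `A` at `0`**: `‖A(v) - (1 - iv²)‖ ≤ 2‖v‖⁴` for `‖v‖ ≤ 1/2`
(`A - (1 - iv²) = -v⁴/(1 + iv²)`). [folklore] -/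
theorem norm_slitAc_sub_le {v : ℂ} (hv : ‖v‖ ≤ 1 / 2) : ‖slitAc v - (1 + -I * v ^ 2)‖ ≤ 2 * ‖v‖ ^ 4 := by
  have hv2 : ‖I * v ^ 2‖ ≤ 1 / 4 := by rw [norm_I_mul_sq]; nlinarith [norm_nonneg v]
  have hden : 3 / 4 ≤ ‖1 + I * v ^ 2‖ := by
    have := norm_sub_norm_le (1 : ℂ) (-(I * v ^ 2))
    rw [norm_neg, norm_one, sub_neg_eq_add] at this
    linarith
  have hne : (1 : ℂ) + I * v ^ 2 ≠ 0 := by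
    intro h; rw [h, norm_zero] at hden; linarith
  have key : slitAc v - (1 + -I * v ^ 2) = -v ^ 4 / (1 + I * v ^ 2) := by
    rw [eq_div_iff hne, sub_mul, slitAc, inv_mul_cancel₀ hne]
    linear_combination v ^ 4 * Complex.I_sq
  rw [key, norm_div, norm_neg, norm_pow, div_le_iff₀ (by linarith)]
  nlinarith [norm_nonneg v, pow_nonneg (norm_nonneg v) 4]

/-- `‖a‖ - |k| ≥ 1/(2‖a‖)` (since `(‖a‖ - |k|)(‖a‖ + |k|) = s² ≥ 1`). [folklore] -/
theorem norm_sub_abs_ge (k : ℤ) {s : ℕ} (hs : 1 ≤ s) : 1 / (2 * ‖slitParam k s‖) ≤ ‖slitParam k s‖ - |(k : ℝ)| := by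
  set n := ‖slitParam k s‖ with hn
  have hn1 : 1 ≤ n := one_le_norm_slitParam k hs
  have hsq := norm_slitParam_sq k s
  rw [← hn] at hsq
  have hk : |(k : ℝ)| ≤ n := by rw [hn, ← slitParam_im k s]; exact abs_im_le_norm _
  have hs1 : (1 : ℝ) ≤ (s : ℝ) ^ 2 := by
    have : (1 : ℝ) ≤ s := by exact_mod_cast hs
    nlinarith
  have h2 : |(k : ℝ)| ^ 2 = (k : ℝ) ^ 2 := sq_abs _
  rw [div_le_iff₀ (by linarith)]
  nlinarith [abs_nonneg (k : ℝ)]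

/-- From a lower bound on `‖1 + iv²‖²` to an upper bound on `‖A(v)‖`. [folklore] -/
theorem norm_slitAc_le_of_sq_le {v : ℂ} {c : ℝ} (hc : 0 < c) (h : c ^ 2 ≤ ‖(1 : ℂ) + I * v ^ 2‖ ^ 2) :
    ‖slitAc v‖ ≤ 1 / c := by
  have h1 : c ≤ ‖(1 : ℂ) + I * v ^ 2‖ := (pow_le_pow_iff_left₀ hc.le (norm_nonneg _) two_ne_zero).1 h
  rw [slitAc, norm_inv, one_div]
  exact inv_anti₀ hc h1

/-- **`A` on the rotated ray**: `‖A(we^{iθ_a})‖ ≤ 2‖a‖` for `w ∈ [0, 1]`. [folklore] -/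
theorem norm_slitAc_ray_le (k : ℤ) {s : ℕ} (hs : 1 ≤ s) {w : ℝ} (hw : w ∈ Icc (0 : ℝ) 1) :
    ‖slitAc ((w : ℂ) * cexp ((rotAngle k s : ℂ) * I))‖ ≤ 2 * ‖slitParam k s‖ := by
  set n := ‖slitParam k s‖ with hn
  have hn1 : 1 ≤ n := one_le_norm_slitParam k hs
  have hn0 : 0 < n := by linarith
  have hsin := sin_two_mul_rotAngle k s
  have hgap := norm_sub_abs_ge k hs
  rw [← hn] at hsin hgap
  set K := (k : ℝ) / n with hK
  set U := |(k : ℝ)| / n with hU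
  have hsq : ‖(1 : ℂ) + I * ((w : ℂ) * cexp ((rotAngle k s : ℂ) * I)) ^ 2‖ ^ 2 = 1 + 2 * w ^ 2 * K + w ^ 4 := by
    rw [normSq_one_add_I_ray, hsin, hK]; ring
  have hk : |(k : ℝ)| ≤ n := by rw [hn, ← slitParam_im k s]; exact abs_im_le_norm _
  have hKU : -U ≤ K := by
    rw [hK, hU, ← neg_div]; exact div_le_div_of_nonneg_right (neg_abs_le _) hn0.le
  have hU1 : U ≤ 1 := by rw [hU, div_le_one hn0]; exact hk
  have hU0 : 0 ≤ U := by positivity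
  have hgap' : 1 ≤ (n - |(k : ℝ)|) * (2 * n) := by
    have := (div_le_iff₀ (by positivity : (0 : ℝ) < 2 * n)).1 hgap
    linarith
  have hγ : 1 / (2 * n ^ 2) ≤ 1 - U := by
    have : 1 - U = (n - |(k : ℝ)|) / n := by rw [hU]; field_simp
    rw [this, div_le_div_iff₀ (by positivity) hn0]
    have := mul_le_mul_of_nonneg_right hgap' hn0.le
    nlinarith
  have hw0 := hw.1
  have hw1 := hw.2
  have hlow : (1 / (2 * n)) ^ 2 ≤ ‖(1 : ℂ) + I * ((w : ℂ) * cexp ((rotAngle k s : ℂ) * I)) ^ 2‖ ^ 2 := by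
    rw [hsq, div_pow, one_pow, mul_pow, show (2 : ℝ) ^ 2 * n ^ 2 = 4 * n ^ 2 by norm_num]
    have h14 : 1 / (4 * n ^ 2) ≤ 1 / 4 := by
      rw [div_le_div_iff₀ (by positivity) (by norm_num)]; nlinarith
    rcases le_or_gt w (1 / 2) with h | h
    · have e1 : 1 + 2 * w ^ 2 * K + w ^ 4 = (1 - w ^ 2) ^ 2 + 2 * w ^ 2 * (K + 1) := by ring
      have e2 : 0 ≤ 2 * w ^ 2 * (K + 1) := mul_nonneg (by positivity) (by linarith)
      have h34 : 3 / 4 ≤ 1 - w ^ 2 := by nlinarith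
      have e3 : (3 / 4 : ℝ) ^ 2 ≤ (1 - w ^ 2) ^ 2 := pow_le_pow_left₀ (by norm_num) h34 2
      rw [e1]; nlinarith
    · have e1 : 1 + 2 * w ^ 2 * K + w ^ 4 = (1 - w ^ 2) ^ 2 + 2 * w ^ 2 * (1 - U) + 2 * w ^ 2 * (K + U) := by ring
      have e2 : 0 ≤ 2 * w ^ 2 * (K + U) := mul_nonneg (by positivity) (by linarith)
      have e3 : 2 * w ^ 2 * (1 / (2 * n ^ 2)) ≤ 2 * w ^ 2 * (1 - U) := mul_le_mul_of_nonneg_left hγ (by positivity)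
      have hw2 : 1 / 4 ≤ w ^ 2 := by nlinarith
      have e4 : 1 / (4 * n ^ 2) ≤ 2 * w ^ 2 * (1 / (2 * n ^ 2)) := by
        rw [show 2 * w ^ 2 * (1 / (2 * n ^ 2)) = w ^ 2 * (1 / n ^ 2) by field_simp]
        rw [show 1 / (4 * n ^ 2) = 1 / 4 * (1 / n ^ 2) by field_simp]
        exact mul_le_mul_of_nonneg_right hw2 (by positivity)
      rw [e1]; nlinarith [sq_nonneg (1 - w ^ 2)]
  have h := norm_slitAc_le_of_sq_le (by positivity) hlow
  rw [one_div_one_div] at h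
  exact h

/-- On the unit circle: `‖1 + ie^{2iφ}‖² = 2 - 2 sin 2φ`. [folklore] -/
theorem normSq_one_add_I_arc (φ : ℝ) : ‖(1 : ℂ) + I * cexp ((φ : ℂ) * I) ^ 2‖ ^ 2 = 2 - 2 * Real.sin (2 * φ) := by
  rw [cexp_eq_one_ray, normSq_one_add_I_ray]; ring

/-- **`A` on the arc near the axis**: `‖A(e^{iφ})‖ ≤ 2` for `|φ| ≤ π/8`. [folklore] -/
theorem norm_slitAc_arc_le_two {φ : ℝ} (hφ : |φ| ≤ π / 8) : ‖slitAc (cexp ((φ : ℂ) * I))‖ ≤ 2 := by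
  have hπ := Real.pi_pos
  have h2φ : |2 * φ| ≤ π / 4 := by rw [abs_mul, abs_two]; linarith
  have hs : |Real.sin (2 * φ)| ≤ Real.sqrt 2 / 2 := by
    rw [abs_sin_eq_sin_abs (by linarith), ← Real.sin_pi_div_four]
    exact Real.sin_le_sin_of_le_of_le_pi_div_two (by linarith [abs_nonneg (2 * φ)]) (by linarith) h2φ
  have hs2 : Real.sqrt 2 / 2 ≤ 3 / 4 := by
    have : Real.sqrt 2 ≤ 3 / 2 := by
      rw [Real.sqrt_le_left (by norm_num)]; norm_num
    linarith
  have hlow : (1 / 2 : ℝ) ^ 2 ≤ ‖(1 : ℂ) + I * cexp ((φ : ℂ) * I) ^ 2‖ ^ 2 := by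
    rw [normSq_one_add_I_arc]
    have := le_abs_self (Real.sin (2 * φ))
    nlinarith
  have h := norm_slitAc_le_of_sq_le (by norm_num) hlow
  norm_num at h
  exact h

/-- **`A` on the whole arc**: `‖A(e^{iφ})‖ ≤ 2‖a‖` for `φ` between `θ_a` and `0`. [folklore] -/
theorem norm_slitAc_arc_le (k : ℤ) {s : ℕ} (hs : 1 ≤ s) {φ : ℝ} (hφ : φ ∈ uIcc (rotAngle k s) 0) :
    ‖slitAc (cexp ((φ : ℂ) * I))‖ ≤ 2 * ‖slitParam k s‖ := by
  have hπ := Real.pi_pos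
  set n := ‖slitParam k s‖ with hn
  have hn1 : 1 ≤ n := one_le_norm_slitParam k hs
  have hn0 : 0 < n := by linarith
  have hθ := abs_rotAngle_lt k hs
  obtain ⟨hφθ, _⟩ := arc_angle_props k hs hφ
  have hgap := norm_sub_abs_ge k hs
  rw [← hn] at hgap
  -- `|sin 2φ| ≤ |sin 2θ| = |k|/n`
  have hsinθ : |Real.sin (2 * rotAngle k s)| = |(k : ℝ)| / n := by
    rw [sin_two_mul_rotAngle, abs_div, abs_neg, abs_norm]
  have hmono : |Real.sin (2 * φ)| ≤ |Real.sin (2 * rotAngle k s)| := by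
    rw [abs_sin_eq_sin_abs (by rw [abs_mul, abs_two]; linarith),
      abs_sin_eq_sin_abs (by rw [abs_mul, abs_two]; linarith)]
    exact Real.sin_le_sin_of_le_of_le_pi_div_two (by linarith [abs_nonneg (2 * φ)])
      (by rw [abs_mul, abs_two]; linarith) (by rw [abs_mul, abs_two, abs_mul, abs_two]; linarith)
  rw [hsinθ] at hmono
  have hlow : (1 / (2 * n)) ^ 2 ≤ ‖(1 : ℂ) + I * cexp ((φ : ℂ) * I) ^ 2‖ ^ 2 := by
    rw [normSq_one_add_I_arc, div_pow, one_pow, mul_pow, show (2 : ℝ) ^ 2 * n ^ 2 = 4 * n ^ 2 by norm_num]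
    have h1 : Real.sin (2 * φ) ≤ |(k : ℝ)| / n := (le_abs_self _).trans hmono
    have h2 : 1 - |(k : ℝ)| / n = (n - |(k : ℝ)|) / n := by field_simp
    have hgap' : 1 ≤ (n - |(k : ℝ)|) * (2 * n) := by
      have := (div_le_iff₀ (by positivity : (0 : ℝ) < 2 * n)).1 hgap
      linarith
    have h3 : 1 / (2 * n ^ 2) ≤ 1 - |(k : ℝ)| / n := by
      rw [h2, div_le_div_iff₀ (by positivity) hn0]
      have := mul_le_mul_of_nonneg_right hgap' hn0.le
      nlinarith
    have h4 : 1 / (4 * n ^ 2) ≤ 1 / (2 * n ^ 2) := by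
      rw [div_le_div_iff₀ (by positivity) (by positivity)]; nlinarith
    have h5 : 0 ≤ 1 / (2 * n ^ 2) := by positivity
    linarith
  have h := norm_slitAc_le_of_sq_le (by positivity) hlow
  rw [one_div_one_div] at h
  exact h

/-! ### The expansion of `J(k, s)` and of `K(k, s)` -/

/-- `J(k, s) = ∫_0^1 (E^kY^sA)(t) dt` in the general-amplitude notation. [folklore] -/
theorem slitJ_eq_integral_slitJg (k : ℤ) (s : ℕ) : slitJ k s = ∫ t in (0 : ℝ)..1, slitJg slitAc k s (t : ℂ) := by
  rw [slitJ]
  exact intervalIntegral.integral_congr fun t _ => (slitJc_ofReal k s t).symm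

/-- **The expansion of `J`**:
`‖J(k,s) - e^{iθ_a}(G₀ - i e^{2iθ_a} G₂)‖ ≤ 4·10⁸/‖a‖²` with the Gaussian moments `G₀, G₂`. [folklore] -/
theorem norm_slitJ_sub_le (k : ℤ) {s : ℕ} (hs : 1 ≤ s) :
    ‖slitJ k s - cexp ((rotAngle k s : ℂ) * I) *
        (((∫ w in Ioi (0 : ℝ), Real.exp (-(2 * ‖slitParam k s‖) * w ^ 2) : ℝ) : ℂ) +
          -I * cexp ((rotAngle k s : ℂ) * I) ^ 2 *
            ((∫ w in Ioi (0 : ℝ), w ^ 2 * Real.exp (-(2 * ‖slitParam k s‖) * w ^ 2) : ℝ) : ℂ))‖ ≤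
      400000000 / ‖slitParam k s‖ ^ 2 := by
  have h := norm_integral_slitJg_sub_main_le (Φ := slitAc) (M := 2) (c₀ := 1) (c₂ := -I) (by norm_num) (by simp)
    (by simp) (fun z hz => differentiableAt_slitAc hz)
    (fun v hv => by have := norm_slitAc_sub_le hv; simpa [mul_comm] using this) k hs
    (fun w hw => norm_slitAc_ray_le k hs hw) (fun φ _ hφ8 => norm_slitAc_arc_le_two hφ8)
    (fun φ hφ => norm_slitAc_arc_le k hs hφ)
  rw [← slitJ_eq_integral_slitJg, one_mul] at h
  refine h.trans (le_of_eq ?_)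
  ring

/-- **The expansion of `J` in closed form**:
`‖J(k,s) - ½√(π/(2‖a‖)) e^{iθ_a} (1 - i e^{2iθ_a}/(4‖a‖))‖ ≤ 4·10⁸/‖a‖²`. [folklore] -/
theorem norm_slitJ_sub_closed_le (k : ℤ) {s : ℕ} (hs : 1 ≤ s) :
    ‖slitJ k s - ((Real.sqrt (π / (2 * ‖slitParam k s‖)) / 2 : ℝ) : ℂ) * cexp ((rotAngle k s : ℂ) * I) *
        (1 - I * cexp ((rotAngle k s : ℂ) * I) ^ 2 / (4 * ‖slitParam k s‖))‖ ≤
      400000000 / ‖slitParam k s‖ ^ 2 := by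
  have hn1 : 1 ≤ ‖slitParam k s‖ := one_le_norm_slitParam k hs
  have hb : 0 < 2 * ‖slitParam k s‖ := by linarith
  have h := norm_slitJ_sub_le k hs
  rw [integral_gaussian_Ioi (2 * ‖slitParam k s‖), integral_sq_mul_exp_neg_mul_sq hb] at h
  refine le_trans (le_of_eq ?_) h
  congr 1
  have hne : (‖slitParam k s‖ : ℂ) ≠ 0 := by exact_mod_cast (by linarith : ‖slitParam k s‖ ≠ 0)
  push_cast
  field_simp
  ring

/-- **The expansion of the slit kernel** `K(k, s) = (4/π) Re(e^{iπ/4} J(k, s))`: for `s ≥ 1`,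
`|K(k,s) - (4/π) Re[e^{iπ/4} · ½√(π/(2‖a‖)) e^{iθ_a}(1 - i e^{2iθ_a}/(4‖a‖))]| ≤ 6·10⁸/‖a‖²`,
`a = s + ik`, `θ_a = -arg(a)/2`. This is the closed-form, quantitative version of the convergence
`δ^{-1/2} F_{[ℂ_δ,a]} → 1/√(z - a)` of Lemma 2.14 (values). [cite: ChelkakHonglerIzyurovAnnals2015, Lemma 2.14] -/
theorem abs_slitKernel_sub_le (k : ℤ) {s : ℕ} (hs : 1 ≤ s) :
    |slitKernel k s - 4 / π * (cexp (π / 4 * I) *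
        (((Real.sqrt (π / (2 * ‖slitParam k s‖)) / 2 : ℝ) : ℂ) * cexp ((rotAngle k s : ℂ) * I) *
          (1 - I * cexp ((rotAngle k s : ℂ) * I) ^ 2 / (4 * ‖slitParam k s‖)))).re| ≤
      600000000 / ‖slitParam k s‖ ^ 2 := by
  have hπ := Real.pi_pos
  have hπ3 := Real.pi_gt_three
  have h := norm_slitJ_sub_closed_le k hs
  set main := ((Real.sqrt (π / (2 * ‖slitParam k s‖)) / 2 : ℝ) : ℂ) * cexp ((rotAngle k s : ℂ) * I) *
    (1 - I * cexp ((rotAngle k s : ℂ) * I) ^ 2 / (4 * ‖slitParam k s‖)) with hmain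
  rw [slitKernel_eq_re_slitJ, ← mul_sub, ← Complex.sub_re, ← mul_sub, abs_mul, abs_of_pos (by positivity)]
  have h1 : |(cexp (π / 4 * I) * (slitJ k s - main)).re| ≤ ‖slitJ k s - main‖ := by
    refine (abs_re_le_norm _).trans ?_
    rw [norm_mul, show (π / 4 : ℂ) * I = ((π / 4 : ℝ) : ℂ) * I by push_cast; ring, Complex.norm_exp_ofReal_mul_I, one_mul]
  have h4 : 4 / π ≤ 3 / 2 := by rw [div_le_div_iff₀ hπ (by norm_num)]; linarith
  have hn : 0 < ‖slitParam k s‖ ^ 2 := by have := one_le_norm_slitParam k hs; positivity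
  calc 4 / π * |(cexp (π / 4 * I) * (slitJ k s - main)).re| ≤ 3 / 2 * (400000000 / ‖slitParam k s‖ ^ 2) :=
        mul_le_mul h4 (h1.trans h) (abs_nonneg _) (by norm_num)
    _ = 600000000 / ‖slitParam k s‖ ^ 2 := by ring

/-! ### The main term in trigonometric form; the near-slit bound; the row `s = 0` -/

/-- **Half-angle identity for the leading phase**: `cos²(π/4 + θ_a) = (‖a‖ + k)/(2‖a‖)`. [folklore] -/
theorem cos_sq_quarter_add_rotAngle (k : ℤ) {s : ℕ} (hs : 1 ≤ s) :
    Real.cos (π / 4 + rotAngle k s) ^ 2 = (‖slitParam k s‖ + k) / (2 * ‖slitParam k s‖) := by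
  have hn : 0 < ‖slitParam k s‖ := by linarith [one_le_norm_slitParam k hs]
  rw [Real.cos_sq, show 2 * (π / 4 + rotAngle k s) = π / 2 + 2 * rotAngle k s by ring, Real.cos_add, Real.cos_pi_div_two,
    Real.sin_pi_div_two, zero_mul, one_mul, zero_sub, sin_two_mul_rotAngle]
  field_simp

/-- **The real part of the main term**:
`Re[e^{iπ/4} · c e^{iθ}(1 - i e^{2iθ}/(4n))] = c (cos(π/4 + θ) + sin(π/4 + 3θ)/(4n))`. [folklore] -/
theorem re_main_term (c θ n : ℝ) :
    (cexp (π / 4 * I) * (((c : ℝ) : ℂ) * cexp ((θ : ℂ) * I) * (1 - I * cexp ((θ : ℂ) * I) ^ 2 / (4 * n)))).re =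
      c * (Real.cos (π / 4 + θ) + Real.sin (π / 4 + 3 * θ) / (4 * n)) := by
  have h1 : cexp (π / 4 * I) * cexp ((θ : ℂ) * I) = cexp (((π / 4 + θ : ℝ) : ℂ) * I) := by
    rw [← Complex.exp_add]; push_cast; ring_nf
  have h3 : cexp (π / 4 * I) * cexp ((θ : ℂ) * I) * cexp ((θ : ℂ) * I) ^ 2 = cexp (((π / 4 + 3 * θ : ℝ) : ℂ) * I) := by
    rw [sq, ← Complex.exp_add, ← Complex.exp_add, ← Complex.exp_add]; push_cast; ring_nf
  have key : cexp (π / 4 * I) * (((c : ℝ) : ℂ) * cexp ((θ : ℂ) * I) * (1 - I * cexp ((θ : ℂ) * I) ^ 2 / (4 * n))) =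
      ((c : ℝ) : ℂ) * (cexp (((π / 4 + θ : ℝ) : ℂ) * I) - I * cexp (((π / 4 + 3 * θ : ℝ) : ℂ) * I) * (((1 / (4 * n) : ℝ)) : ℂ)) := by
    rw [← h1, ← h3]; push_cast; ring
  rw [key, re_ofReal_mul, Complex.sub_re, Complex.exp_ofReal_mul_I_re]
  congr 1
  rw [show I * cexp (((π / 4 + 3 * θ : ℝ) : ℂ) * I) * (((1 / (4 * n) : ℝ)) : ℂ) =
    (((1 / (4 * n) : ℝ)) : ℂ) * (I * cexp (((π / 4 + 3 * θ : ℝ) : ℂ) * I)) by ring, re_ofReal_mul, Complex.mul_re,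
    Complex.I_re, Complex.I_im, Complex.exp_ofReal_mul_I_im, zero_mul, one_mul, zero_sub]
  ring

/-- `(4/π) · ½√(π/(2n)) = √(2/(πn))`. [folklore] -/
theorem four_div_pi_mul_sqrt (n : ℝ) (hn : 0 < n) : 4 / π * (Real.sqrt (π / (2 * n)) / 2) = Real.sqrt (2 / (π * n)) := by
  have hπ := Real.pi_pos
  have h1 : 4 / π * (Real.sqrt (π / (2 * n)) / 2) = 2 / π * Real.sqrt (π / (2 * n)) := by ring
  rw [h1, eq_comm, Real.sqrt_eq_iff_mul_self_eq (by positivity) (by positivity)]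
  rw [show 2 / π * Real.sqrt (π / (2 * n)) * (2 / π * Real.sqrt (π / (2 * n))) =
    (2 / π) ^ 2 * (Real.sqrt (π / (2 * n)) * Real.sqrt (π / (2 * n))) by ring, Real.mul_self_sqrt (by positivity)]
  field_simp

/-- **The expansion of the slit kernel, trigonometric form**: for `s ≥ 1` and all `k`,
`|K(k, s) - √(2/(π‖a‖)) [cos(π/4 + θ_a) + sin(π/4 + 3θ_a)/(4‖a‖)]| ≤ 6·10⁸/‖a‖²`.
[cite: ChelkakHonglerIzyurovAnnals2015, Lemma 2.14] -/
theorem abs_slitKernel_sub_trig_le (k : ℤ) {s : ℕ} (hs : 1 ≤ s) :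
    |slitKernel k s - Real.sqrt (2 / (π * ‖slitParam k s‖)) *
        (Real.cos (π / 4 + rotAngle k s) + Real.sin (π / 4 + 3 * rotAngle k s) / (4 * ‖slitParam k s‖))| ≤
      600000000 / ‖slitParam k s‖ ^ 2 := by
  have hn : 0 < ‖slitParam k s‖ := by linarith [one_le_norm_slitParam k hs]
  have h := abs_slitKernel_sub_le k hs
  rw [re_main_term, ← mul_assoc, four_div_pi_mul_sqrt _ hn] at h
  exact h

/-- **The near-slit bound** (CHI (3.5): `hm ≤ C δ^{1/2}|Im(z-a)| |z-a|^{-3/2}` near the cut): for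
`k ≤ 0` and `s ≥ 1`, `|K(k, s)| ≤ 7·10⁸ · s/(‖a‖√‖a‖)`. [cite: ChelkakHonglerIzyurovAnnals2015, Lemma 3.4 (3.5)] -/
theorem abs_slitKernel_le_near_slit {k : ℤ} (hk : k ≤ 0) {s : ℕ} (hs : 1 ≤ s) :
    |slitKernel k s| ≤ 700000000 * s / (‖slitParam k s‖ * Real.sqrt ‖slitParam k s‖) := by
  have hπ := Real.pi_pos
  have hπ3 := Real.pi_gt_three
  set n := ‖slitParam k s‖ with hn
  have hn1 : 1 ≤ n := one_le_norm_slitParam k hs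
  have hn0 : 0 < n := by linarith
  have hsq1 : 1 ≤ Real.sqrt n := by rw [Real.le_sqrt (by norm_num) hn0.le]; linarith
  have hsqn : Real.sqrt n ≤ n := by rw [Real.sqrt_le_left hn0.le]; nlinarith
  have hsq0 : 0 < Real.sqrt n := by linarith
  have hs1 : (1 : ℝ) ≤ s := by exact_mod_cast hs
  have h := abs_slitKernel_sub_trig_le k hs
  rw [← hn] at h
  -- the leading coefficient `√(2/(πn)) ≤ 1/√n`
  have hcoef : Real.sqrt (2 / (π * n)) ≤ 1 / Real.sqrt n := by
    rw [Real.sqrt_le_left (by positivity), div_pow, one_pow, Real.sq_sqrt hn0.le, div_le_div_iff₀ (by positivity) hn0]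
    nlinarith
  have hcoef0 : 0 ≤ Real.sqrt (2 / (π * n)) := Real.sqrt_nonneg _
  -- `|cos(π/4 + θ)| ≤ s/n`
  have hcos : |Real.cos (π / 4 + rotAngle k s)| ≤ s / n := by
    have h2 := cos_sq_quarter_add_rotAngle k hs
    rw [← hn] at h2
    have hk' : (k : ℝ) ≤ 0 := by exact_mod_cast hk
    have hgap : n + k ≤ (s : ℝ) ^ 2 / n := by
      -- `(n + k)(n - k) = s²` and `n - k ≥ n`
      have hsqn' := norm_slitParam_sq k s
      rw [← hn] at hsqn'
      rw [le_div_iff₀ hn0]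
      nlinarith
    have h3 : Real.cos (π / 4 + rotAngle k s) ^ 2 ≤ (s / n) ^ 2 := by
      rw [h2, div_pow, div_le_div_iff₀ (by positivity) (by positivity)]
      have := mul_le_mul_of_nonneg_right hgap (by positivity : (0 : ℝ) ≤ n ^ 2)
      have hh : (s : ℝ) ^ 2 / n * n ^ 2 = (s : ℝ) ^ 2 * n := by field_simp
      nlinarith
    exact abs_le.2 (abs_le_of_sq_le_sq' h3 (by positivity))
  have hsin : |Real.sin (π / 4 + 3 * rotAngle k s) / (4 * n)| ≤ 1 / n := by
    rw [abs_div, abs_of_pos (show (0 : ℝ) < 4 * n by positivity), div_le_div_iff₀ (by positivity) hn0]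
    nlinarith [Real.abs_sin_le_one (π / 4 + 3 * rotAngle k s)]
  -- assemble
  have hmain : |Real.sqrt (2 / (π * n)) * (Real.cos (π / 4 + rotAngle k s) + Real.sin (π / 4 + 3 * rotAngle k s) / (4 * n))| ≤
      1 / Real.sqrt n * ((s + 1) / n) := by
    rw [abs_mul, abs_of_nonneg hcoef0]
    refine mul_le_mul hcoef ((abs_add_le _ _).trans ?_) (abs_nonneg _) (by positivity)
    rw [add_div]; exact add_le_add hcos hsin
  have hK : |slitKernel k s| ≤ 1 / Real.sqrt n * ((s + 1) / n) + 600000000 / n ^ 2 := by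
    have := abs_sub_abs_le_abs_sub (slitKernel k s) (Real.sqrt (2 / (π * n)) *
      (Real.cos (π / 4 + rotAngle k s) + Real.sin (π / 4 + 3 * rotAngle k s) / (4 * n)))
    linarith
  refine hK.trans ?_
  -- `1/√n · (s+1)/n + 6e8/n² ≤ 7e8 s/(n √n)`
  have e1 : 1 / Real.sqrt n * ((s + 1) / n) = (s + 1) / (n * Real.sqrt n) := by field_simp
  have e0 : n * Real.sqrt n ≤ n ^ 2 := by nlinarith
  have e2 : 600000000 / n ^ 2 ≤ 600000000 * s / (n * Real.sqrt n) := by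
    rw [div_le_div_iff₀ (by positivity) (by positivity)]
    have := mul_le_mul e0 hs1 (by norm_num) (by positivity)
    nlinarith
  have e3 : (s + 1) / (n * Real.sqrt n) ≤ 2 * s / (n * Real.sqrt n) := div_le_div_of_nonneg_right (by linarith) (by positivity)
  rw [e1]
  calc (s + 1) / (n * Real.sqrt n) + 600000000 / n ^ 2 ≤ 2 * s / (n * Real.sqrt n) + 600000000 * s / (n * Real.sqrt n) :=
        add_le_add e3 e2
    _ = 600000002 * s / (n * Real.sqrt n) := by ring
    _ ≤ 700000000 * s / (n * Real.sqrt n) := by gcongr; norm_num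

/-- **The row `s = 0`** (the cut direction `R_a`): for `m ≥ 1`,
`K(2m, 0) = ½[K(2m-1, 1) + K(2m+1, 1)]` is within `6·10⁸/m²` of the average of the two
trigonometric main terms. [cite: ChelkakHonglerIzyurovAnnals2015, Lemma 2.14] -/
theorem abs_slitKernel_row_sub_le {m : ℤ} (hm : 1 ≤ m) :
    |slitKernel (2 * m) 0 - 1 / 2 *
        (Real.sqrt (2 / (π * ‖slitParam (2 * m - 1) 1‖)) *
            (Real.cos (π / 4 + rotAngle (2 * m - 1) 1) + Real.sin (π / 4 + 3 * rotAngle (2 * m - 1) 1) / (4 * ‖slitParam (2 * m - 1) 1‖)) +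
          Real.sqrt (2 / (π * ‖slitParam (2 * m + 1) 1‖)) *
            (Real.cos (π / 4 + rotAngle (2 * m + 1) 1) + Real.sin (π / 4 + 3 * rotAngle (2 * m + 1) 1) / (4 * ‖slitParam (2 * m + 1) 1‖)))| ≤
      600000000 / (m : ℝ) ^ 2 := by
  have hrow := slitKernel_row_of_pos (by omega : 0 < m)
  have h1 := abs_slitKernel_sub_trig_le (2 * m - 1) (le_refl 1)
  have h2 := abs_slitKernel_sub_trig_le (2 * m + 1) (le_refl 1)
  have hm' : (1 : ℝ) ≤ m := by exact_mod_cast hm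
  -- `‖a_±‖ ≥ |2m ± 1| ≥ m`
  have hn1 : (m : ℝ) ≤ ‖slitParam (2 * m - 1) 1‖ := by
    have := abs_im_le_norm (slitParam (2 * m - 1) 1)
    rw [slitParam_im] at this; push_cast at this
    have h3 : (m : ℝ) ≤ |2 * (m : ℝ) - 1| := by rw [abs_of_pos (by linarith)]; linarith
    linarith
  have hn2 : (m : ℝ) ≤ ‖slitParam (2 * m + 1) 1‖ := by
    have := abs_im_le_norm (slitParam (2 * m + 1) 1)
    rw [slitParam_im] at this; push_cast at this
    have h3 : (m : ℝ) ≤ |2 * (m : ℝ) + 1| := by rw [abs_of_pos (by linarith)]; linarith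
    linarith
  have hb1 : 600000000 / ‖slitParam (2 * m - 1) 1‖ ^ 2 ≤ 600000000 / (m : ℝ) ^ 2 := by
    apply div_le_div_of_nonneg_left (by norm_num) (by positivity)
    exact pow_le_pow_left₀ (by linarith) hn1 2
  have hb2 : 600000000 / ‖slitParam (2 * m + 1) 1‖ ^ 2 ≤ 600000000 / (m : ℝ) ^ 2 := by
    apply div_le_div_of_nonneg_left (by norm_num) (by positivity)
    exact pow_le_pow_left₀ (by linarith) hn2 2
  rw [hrow]
  have key := abs_add_le (1 / 2 * (slitKernel (2 * m - 1) 1 - Real.sqrt (2 / (π * ‖slitParam (2 * m - 1) 1‖)) *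
      (Real.cos (π / 4 + rotAngle (2 * m - 1) 1) + Real.sin (π / 4 + 3 * rotAngle (2 * m - 1) 1) / (4 * ‖slitParam (2 * m - 1) 1‖))))
    (1 / 2 * (slitKernel (2 * m + 1) 1 - Real.sqrt (2 / (π * ‖slitParam (2 * m + 1) 1‖)) *
      (Real.cos (π / 4 + rotAngle (2 * m + 1) 1) + Real.sin (π / 4 + 3 * rotAngle (2 * m + 1) 1) / (4 * ‖slitParam (2 * m + 1) 1‖))))
  rw [abs_mul, abs_mul, abs_of_pos (by norm_num : (0 : ℝ) < 1 / 2)] at key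
  refine le_trans (le_of_eq ?_) (key.trans ?_)
  · congr 1; ring
  · linarith
end Literature.Probability.LatticeModels
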